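import Summits.NavierStokesRegularity.NavierStokesRegularity.Theses.AdaptedFrequency
import Summits.NavierStokesRegularity.NavierStokesRegularity.Theorems.AdaptedFrequencyFrequencyRigidityFrameNormalisation
import Summits.NavierStokesRegularity.NavierStokesRegularity.Theorems.AdaptedFrequencyFrequencyRigidityFiniteBridges
import Summits.NavierStokesRegularity.NavierStokesRegularity.Theorems.AdaptedFrequencyFrequencyRigidityFiniteAxisymmetricLeaf
import Summits.NavierStokesRegularity.NavierStokesRegularity.Theorems.AdaptedFrequencyFrequencyRigidityFiniteOfNoLocalTypeISingularity
import Summits.NavierStokesRegularity.NavierStokesRegularity.Theorems.AdaptedFrequencyFrequencyRigidityScaledEnergySplitGlue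
import Summits.NavierStokesRegularity.NavierStokesRegularity.Theorems.AdaptedFrequencyFrequencyRigidityFiniteRSSProfileDecay
import Summits.NavierStokesRegularity.NavierStokesRegularity.Theorems.AdaptedFrequencyFrequencyRigidityFiniteRSSExtremes
import Summits.NavierStokesRegularity.NavierStokesRegularity.Theorems.AdaptedFrequencyFrequencyRigidityRSSDecaySuitableInBall
import Summits.NavierStokesRegularity.NavierStokesRegularity.Theorems.AdaptedFrequencyFrequencyRigidityRSSTypeIBoundOfBall
import Summits.NavierStokesRegularity.NavierStokesRegularity.Theorems.AdaptedFrequencyFrequencyRigidityFiniteClassWall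
import Summits.NavierStokesRegularity.NavierStokesRegularity.Theorems.AdaptedFrequencyFrequencyRigidityFiniteABGlue
import Summits.NavierStokesRegularity.NavierStokesRegularity.Theorems.AdaptedFrequencyFrequencyRigidityFiniteABGlueRoute
import Summits.NavierStokesRegularity.NavierStokesRegularity.Theorems.AdaptedFrequencyTangentFlowTransferFiniteAB
import Summits.NavierStokesRegularity.NavierStokesRegularity.Theorems.AdaptedFrequencyFrequencyRigidityFiniteABAxisymmetric
import Summits.NavierStokesRegularity.NavierStokesRegularity.Theorems.AdaptedFrequencyFrequencyRigidityFiniteABSmallEnergy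
import Summits.NavierStokesRegularity.NavierStokesRegularity.Theorems.AdaptedFrequencyFrequencyRigidityFiniteABRSSWitnessDecays
import Literature.Analysis.FluidPDE.LocalTypeI
import Literature.Analysis.FluidPDE.PineauVicolRSS
import Literature.Analysis.FluidPDE.PineauVicolCylinderRegularity
import Summits.NavierStokesRegularity.NavierStokesRegularity.Theorems.AdaptedFrequencyFrequencyRigidityFlatBackwardSingular
import Summits.NavierStokesRegularity.NavierStokesRegularity.Theorems.AdaptedFrequencyFrequencyRigiditySmallScaledEnergyRegular
import Summits.NavierStokesRegularity.NavierStokesRegularity.Theorems.AdaptedFrequencyFrequencyRigidityRSSWitnessDecays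
import Summits.NavierStokesRegularity.NavierStokesRegularity.Theorems.AdaptedFrequencyFrequencyRigidityRSSWitnessWindow
import HarnessLib

/-!
# Line `scaled-energy-split` on crux `FrequencyRigidity` (stmt-NavierStokesRegularity-2955) — checked skeleton

LEAD c9 (prover-line-stmt-NavierStokesRegularity-2955-c9-0, 2026-08-17): skeleton v4.2 — the ENABLER CYCLE (+ wave 3: the c6/c7 dictionary ported to the A–B form, p157347 p157528 p157940).  Stub 2 is now
DERIVED from its Albritton–Barker form Stub 2′ `stub_finiteScaledEnergyLiouvilleAB` (∃ suitable pressure + weak gradient on the slab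
with `typeIBound < ⊤`, at viscosity ν; = stmt-1588's class at ν = 1) via the landed glue `finiteAB_stub2_of_stub2AB`; the composition
goes through `frequencyRigidity_of_stub2AB_of_stub3`; sorries = Stub 2′ + quarantined Stub 3.  What c9 built around the skeleton (all
`--supports 2955`): the R1 ENABLER `tangentFlowTransfer_finiteAB` (Theorems/AdaptedFrequencyTangentFlowTransferFiniteAB.lean —
TangentFlowTransfer's hypotheses ⇒ its conclusion ∧ the tangent flow is in the A–B class; Seregin's A–B extraction FIRST, the route's
C²_loc extraction along the same dyadic scales, limits identified a.e.; pieces …FiniteABZoomData (p155313), …FiniteABTools (p155666),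
…FiniteABZoomLimit, …FiniteABDilation) and the glue `finiteAB_closes` / `finiteAB_navierStokesRegularity_of_finiteChild :
AdaptedFrequencyConverges → Stub 2′ → NoTypeII → NavierStokesRegularity` — i.e. the route closes from the FINITE child alone and Stub 3
(⊇ bounded RSS-Liouville ∀α, BT OP 5.2) can be dropped by the planner's restatement (R1) NOW.  Open core unchanged: Stub 2′ ⊇ PV Conj 1.1
on its window.

LEAD c7 (prover-line-stmt-NavierStokesRegularity-2955-c7-0, 2026-08-17): skeleton v3.4 — all c7 sub-goals of Stub 2 LANDED
(A p143572, B p141458, C1 p143077 + tools p142554, C2 p141886, D p141479; wave 2: E p144180 — the small-scaled-energy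
gap; wave 3: F p144967 + lead's H p145941 / G p147093 — any viscosity; wave 4: I p149629 `stub_finiteRDSSExtremes` — the
rotated-DISCRETELY-self-similar analogue of (B), PV Thm 1.7, landed as `Theorems/…FiniteRDSSExtremes.lean` (not imported
here); all discharged by import, so the sorries are again exactly Stub 2 and Stub 3).  This is skeleton v3.4.  v3.2 = v3.1 unchanged in its three
registered stubs and composition (Stub 1 closed by import, Stub 2 open = the lead's stub, Stub 3 quarantined); this
cycle registers and attacks three SUB-GOALS of Stub 2 that pin its rotated-self-similar content to Pineau–Vicol's
Conjecture 1.1 exactly: (A) `stub_finiteRSSProfileDecay` — an RSS witness of the finite piece has a PV-decaying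
profile `‖U(y)‖ ≤ C₀/(1+‖y‖)` (Tsai 1998 §4 transplanted to RSS: the top singular set of the unit backward cylinder is
`μH[1]`-null, while the `t = 0` singular set of an RSS flow with a non-decay direction contains a spiral whose norm-image
is an interval); (B) `stub_finiteRSSExtremes` — hence PV Thm 1.4 closes the RSS case of Stub 2 for `|α| ∉ [α₁, α₂]`;
(C) `stub_rssDecayFiniteTypeIBound` — decaying RSS profiles have `𝐈 < ∞`, so Stub 2 ⇒ PV Conj. 1.1 (finite-class wall).

LEAD c6 (prover-line-stmt-NavierStokesRegularity-2955-c6-0, 2026-08-17): skeleton v3.1.  The three stubs are stated with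
EXPANDED one-line signatures (no `Sig.*` alias) so that `Theorems/` files prove them textually; `Sig.*` kept as
abbreviations, definitionally equal; composition unchanged.  STATUS: Stub 1 `stub_frameNormalisation` CLOSED
(p137350, imported below — no sorry); Stub 2 OPEN with landed leaves: every witness is BACKWARD-SINGULAR at the
pole (p138027/p138216 `isBackwardSingularPoint_of_witness`), viscosity normalisation (p139423), 𝐈 finite under
time dilation (p138844), classical ⇒ suitable on the slab (p139155), hence Stub 2 ⇐ stmt-1588 `NoTypeIRateProfile`
(`stub_finiteOfNoTypeIRateProfile`, p139630), Stub 2 ⇐ ¬`LocalTypeISingularityExists` (Albritton–Barker's first bullet;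
`stub_finiteOfNoLocalTypeISingularity`, p139946, via p139845), the AXISYMMETRIC case of Stub 2 is CLOSED
(`stub_finiteAxisymmetricLeaf`, p139846, Seregin–Šverák Thm 3.1 via the ν = 1 core p139715), and the split is EXACT
with the finite child ⇔ its frame-0 form (`stub_scaledEnergySplitGlue`, `finitePiece_iff_frame0`, p139934); Stub 3
QUARANTINED (route-irrelevant, never briefed).  Sorries: Stub 2, Stub 3.  Open core of Stub 2: Pineau–Vicol 2026
Conj. 1.1 on its window (Morrey-decaying class) — crux-sized; the lead reports `promote-stub`.

Crux-strategist line (wall-breaker `cstrat-stmt-NavierStokesRegularity-2955-p1`, 2026-08-17).  Card: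
`Lines/scaled-energy-split.md`; census: `STRATEGY-CENSUS.md` (same directory).

THE LINE IS A DECOMPOSITION, NOT A MECHANISM.  Every gen-1/gen-2 line died at a terminal stub that CONTAINS
the bounded NON-decaying rotated-self-similar Liouville problem (Bradshaw–Tsai OP 5.2; lead c5 dossiers).
That containment is an artefact of the crux's CLASS (classical + time-Type-I, no local energy control), not
of the route's mathematics: the route only ever feeds the crux tangent flows of finite-energy Type-I-RATE
blow-ups, and those carry a FINITE Albritton–Barker quantity `𝐈 = typeIBound (ℝ₋ × ℝ³) v q ∇v`
(A–B 2019 Lemma 2.5 / Remark 3.2 — tree THEOREM `albrittonBarker2019_lemma_2_5_rate_holds`; lower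
semicontinuity along the zoom as in the PROVED item `TypeIBlowupProfile`, stmt-1591).  Non-decaying RSS
profiles blow up on the whole slice `t = 0` and have `𝐈 = ⊤` in every Galilean frame.  So the crux splits
EXACTLY into

* `stub_finiteScaledEnergyLiouville` — the flat Liouville theorem in the A–B class (frame `B ≡ 0`):
  the piece the route needs; implied by the sibling targets stmt-1588 (`NoTypeIRateProfile`, bridge wanted)
  and stmt-4050 (`TypeIAncientLiouville`, via p121984); open core = Pineau–Vicol 2026 Conj. 1.1 on its
  window, DECAYING class (the extremes are the tree theorem `pineauVicol2026_rss_liouville_holds` up to a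
  Morrey→pointwise lemma);
* `stub_frameNormalisation` — Galilean gauge fixing: the frame-`0` statement implies the frame-invariant one
  (the witness class is wobble-invariant: `Negative.witness_wobble`, LANDED; `𝐈` of the wobbled triple is the
  finite quantity of the frame predicate, `Negative.fderiv_wobbleDrift`);
* `stub_infiniteScaledEnergyLiouville` — the genuinely NON-decaying core (`𝐈 = ⊤` in every Type-I frame;
  ⊇ OP 5.2): ROUTE-IRRELEVANT once `TangentFlowTransfer` (10494) is strengthened and `closes` consumes the
  finite piece — recorded so that the composition is honest; NOT to be staffed (promote / split instead).

`FrequencyRigidity_of` composes the three into the crux BY NAME (excluded middle on the frame predicate).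
The two Liouville stubs are the children `FrequencyRigidityFiniteScaledEnergy` (∃-frame form) /
`FrequencyRigidityInfiniteScaledEnergy` of the prepared `route edit --split` (children.json + glue evidence
`AdaptedFrequencyFrequencyRigidityScaledEnergySplit.lean` on the item; the split verb opens on a final cycle).

Disproof used: honours (B) `frequencyRigidity_false_with_local_typeI` — every stub keeps the GLOBAL Type-I
bound of the body (the A–B clause restricts the class, it does not localise the bound; rigid rotation has
`𝐈 = ⊤` and is not Type-I); (A) positivity and (T) `Λ₀ = 2`, `H = A(−t)⁻²` are inherited unchanged; (W) the
RSS wall `rssWall_unconditional` lands inside `stub_infiniteScaledEnergyLiouville` for non-decaying profiles and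
inside `stub_finiteScaledEnergyLiouville` only for Morrey-decaying ones (PV's class), which is the point.
-/

set_option linter.dupNamespace false

namespace Summit.NavierStokesRegularity.NavierStokesRegularity.Cruxes.FrequencyRigidity.ScaledEnergySplit

/-! ### Abbreviations (named `Prop`s, definitionally the registered signatures below) -/

/-- Abbreviation of Stub 2's statement: the FRAME-0 finite-scaled-energy flat Liouville — no inhabitant of the crux
body with `typeIBound (ℝ₋ × ℝ³) v q ∇v < ⊤` (Albritton–Barker class, given Galilean frame). -/
def Sig.stub_finiteScaledEnergyLiouville : Prop :=
  ¬ ∃ (ν C Λ₀ : ℝ) (v : ℝ → EuclideanSpace ℝ (Fin 3) → EuclideanSpace ℝ (Fin 3)) (q : ℝ → EuclideanSpace ℝ (Fin 3) → ℝ) (K : ℝ → EuclideanSpace ℝ (Fin 3) → ℝ), (0 < ν ∧ Literature.Analysis.FluidPDE.IsClassicalNSSolutionOn (Set.Iio 0) ν 0 v q ∧ (∀ t ∈ Set.Iio (0:ℝ), ∀ x, ‖v t x‖ ≤ C / Real.sqrt (-t)) ∧ ContDiffOn ℝ 2 (Function.uncurry K) (Set.Iio (0:ℝ) ×ˢ Set.univ)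 ∧ (∀ t ∈ Set.Iio (0:ℝ), ∀ x, 0 < K t x) ∧ (∀ t ∈ Set.Iio (0:ℝ), ∀ x, Literature.Analysis.FluidPDE.timeDerivWithin (Set.Iio (0:ℝ)) K t x + fderiv ℝ (K t) x (v t x) + ν * Laplacian.laplacian (K t) x = 0) ∧ (∀ t ∈ Set.Iio (0:ℝ), ∫ x, K t x = 1) ∧ (∀ φ : EuclideanSpace ℝ (Fin 3) → ℝ, Continuous φ → (∃ M : ℝ, ∀ x, |φ x| ≤ M) → Filter.Tendsto (fun t => ∫ x, φ x * K t x) (nhdsWithin (0:ℝ) (Set.Iio (0:ℝ))) (nhds (φ (0 : EuclideanSpace ℝ (Fin 3))))) ∧ (∃ c₁ c₂ C₁ C₂ : ℝ, 0 < c₁ ∧ 0 < c₂ ∧ 0 < C₁ ∧ 0 < C₂ ∧ ∀ t ∈ Set.Iio (0:ℝ), ∀ x, c₁ * ((0:ℝ) - t) ^ (-(3:ℝ) / 2) * Real.exp (-(‖x - (0 : EuclideanSpace ℝ (Fin 3))‖ ^ 2) / (c₂ * ((0:ℝ) - t))) ≤ K t x ∧ K t x ≤ C₁ * ((0:ℝ)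 - t) ^ (-(3:ℝ) / 2) * Real.exp (-(‖x - (0 : EuclideanSpace ℝ (Fin 3))‖ ^ 2) / (C₂ * ((0:ℝ) - t)))) ∧ (∀ H Λ : ℝ → ℝ, H = (fun t => ∫ x, ‖Literature.Analysis.FluidPDE.curl (v t) x‖ ^ 2 * K t x) → Λ = (fun t => (0 - t) * deriv H t / H t) → (∀ t ∈ Set.Iio (0:ℝ), 0 < H t) ∧ (∀ t ∈ Set.Iio (0:ℝ), Λ t = Λ₀))) ∧ Literature.Analysis.FluidPDE.typeIBound (Set.Iio (0:ℝ) ×ˢ Set.univ) v q (fun t x => fderiv ℝ (v t) x) < ⊤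

/-- The frame-invariant finite piece (= child `FrequencyRigidityFiniteScaledEnergy` of the prepared split): no
inhabitant admitting a smooth Type-I Galilean frame `B` ending at the pole in which the wobbled triple has finite `𝐈`. -/
def Sig.finiteScaledEnergyPiece : Prop :=
  ¬ ∃ (ν C Λ₀ : ℝ) (v : ℝ → EuclideanSpace ℝ (Fin 3) → EuclideanSpace ℝ (Fin 3)) (q : ℝ → EuclideanSpace ℝ (Fin 3) → ℝ) (K : ℝ → EuclideanSpace ℝ (Fin 3) → ℝ), (0 < ν ∧ Literature.Analysis.FluidPDE.IsClassicalNSSolutionOn (Set.Iio 0) ν 0 v q ∧ (∀ t ∈ Set.Iio (0:ℝ), ∀ x, ‖v t x‖ ≤ C / Real.sqrt (-t)) ∧ ContDiffOn ℝ 2 (Function.uncurry K) (Set.Iio (0:ℝ) ×ˢ Set.univ) ∧ (∀ t ∈ Set.Iio (0:ℝ), ∀ x, 0 < K t x) ∧ (∀ t ∈ Set.Iio (0:ℝ), ∀ x, Literature.Analysis.FluidPDE.timeDerivWithin (Set.Iio (0:ℝ)) K t x + fderiv ℝ (K t) x (v t x) + ν * Laplacian.laplacian (K t) x = 0) ∧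 (∀ t ∈ Set.Iio (0:ℝ), ∫ x, K t x = 1) ∧ (∀ φ : EuclideanSpace ℝ (Fin 3) → ℝ, Continuous φ → (∃ M : ℝ, ∀ x, |φ x| ≤ M) → Filter.Tendsto (fun t => ∫ x, φ x * K t x) (nhdsWithin (0:ℝ) (Set.Iio (0:ℝ))) (nhds (φ (0 : EuclideanSpace ℝ (Fin 3))))) ∧ (∃ c₁ c₂ C₁ C₂ : ℝ, 0 < c₁ ∧ 0 < c₂ ∧ 0 < C₁ ∧ 0 < C₂ ∧ ∀ t ∈ Set.Iio (0:ℝ), ∀ x, c₁ * ((0:ℝ) - t) ^ (-(3:ℝ) / 2) * Real.exp (-(‖x - (0 : EuclideanSpace ℝ (Fin 3))‖ ^ 2) / (c₂ * ((0:ℝ) - t))) ≤ K t x ∧ K t x ≤ C₁ * ((0:ℝ) - t) ^ (-(3:ℝ) / 2) * Real.exp (-(‖x - (0 : EuclideanSpace ℝ (Fin 3))‖ ^ 2) / (C₂ * ((0:ℝ) - t)))) ∧ (∀ H Λ : ℝ → ℝ, H = (fun t => ∫ x, ‖Literature.Analysis.FluidPDE.curl (v t) x‖ ^ 2 * K t x)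 → Λ = (fun t => (0 - t) * deriv H t / H t) → (∀ t ∈ Set.Iio (0:ℝ), 0 < H t) ∧ (∀ t ∈ Set.Iio (0:ℝ), Λ t = Λ₀))) ∧ (∃ (B : ℝ → EuclideanSpace ℝ (Fin 3)) (C_B : ℝ), ContDiffOn ℝ (⊤ : ℕ∞) B (Set.Iio (0:ℝ)) ∧ (∀ t < (0:ℝ), ‖deriv B t‖ ≤ C_B / Real.sqrt (-t)) ∧ Filter.Tendsto B (nhdsWithin (0:ℝ) (Set.Iio (0:ℝ))) (nhds (0 : EuclideanSpace ℝ (Fin 3))) ∧ Literature.Analysis.FluidPDE.typeIBound (Set.Iio (0:ℝ) ×ˢ Set.univ) (fun t x => v t (x - B t) + deriv B t) (fun t x => q t (x - B t) - inner ℝ (deriv (deriv B) t) x) (fun t x => fderiv ℝ (v t) (x - B t)) < ⊤)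

/-- Abbreviation of Stub 1's statement: Galilean gauge fixing, frame-0 form ⇒ frame-invariant form. -/
def Sig.stub_frameNormalisation : Prop :=
  Sig.stub_finiteScaledEnergyLiouville → Sig.finiteScaledEnergyPiece

/-- Abbreviation of Stub 3's statement (= child `FrequencyRigidityInfiniteScaledEnergy` of the prepared split): no
inhabitant with `𝐈 = ⊤` in EVERY smooth Type-I Galilean frame ending at the pole — the non-decaying core. -/
def Sig.stub_infiniteScaledEnergyLiouville : Prop :=
  ¬ ∃ (ν C Λ₀ : ℝ) (v : ℝ → EuclideanSpace ℝ (Fin 3) → EuclideanSpace ℝ (Fin 3)) (q : ℝ → EuclideanSpace ℝ (Fin 3) → ℝ) (K : ℝ → EuclideanSpace ℝ (Fin 3) → ℝ), (0 < ν ∧ Literature.Analysis.FluidPDE.IsClassicalNSSolutionOn (Set.Iio 0) ν 0 v q ∧ (∀ t ∈ Set.Iio (0:ℝ), ∀ x, ‖v t x‖ ≤ C / Real.sqrt (-t)) ∧ ContDiffOn ℝ 2 (Function.uncurry K) (Set.Iio (0:ℝ) ×ˢ Set.univ) ∧ (∀ t ∈ Set.Iio (0:ℝ), ∀ x, 0 <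 K t x) ∧ (∀ t ∈ Set.Iio (0:ℝ), ∀ x, Literature.Analysis.FluidPDE.timeDerivWithin (Set.Iio (0:ℝ)) K t x + fderiv ℝ (K t) x (v t x) + ν * Laplacian.laplacian (K t) x = 0) ∧ (∀ t ∈ Set.Iio (0:ℝ), ∫ x, K t x = 1) ∧ (∀ φ : EuclideanSpace ℝ (Fin 3) → ℝ, Continuous φ → (∃ M : ℝ, ∀ x, |φ x| ≤ M) → Filter.Tendsto (fun t => ∫ x, φ x * K t x) (nhdsWithin (0:ℝ) (Set.Iio (0:ℝ))) (nhds (φ (0 : EuclideanSpace ℝ (Fin 3))))) ∧ (∃ c₁ c₂ C₁ C₂ : ℝ, 0 < c₁ ∧ 0 < c₂ ∧ 0 < C₁ ∧ 0 < C₂ ∧ ∀ t ∈ Set.Iio (0:ℝ), ∀ x, c₁ * ((0:ℝ) - t) ^ (-(3:ℝ) / 2) * Real.exp (-(‖x - (0 : EuclideanSpace ℝ (Fin 3))‖ ^ 2) / (c₂ * ((0:ℝ) - t))) ≤ K t x ∧ K t x ≤ C₁ * ((0:ℝ) - t) ^ (-(3:ℝ) / 2) * Real.exp (-(‖x - (0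 : EuclideanSpace ℝ (Fin 3))‖ ^ 2) / (C₂ * ((0:ℝ) - t)))) ∧ (∀ H Λ : ℝ → ℝ, H = (fun t => ∫ x, ‖Literature.Analysis.FluidPDE.curl (v t) x‖ ^ 2 * K t x) → Λ = (fun t => (0 - t) * deriv H t / H t) → (∀ t ∈ Set.Iio (0:ℝ), 0 < H t) ∧ (∀ t ∈ Set.Iio (0:ℝ), Λ t = Λ₀))) ∧ ¬ (∃ (B : ℝ → EuclideanSpace ℝ (Fin 3)) (C_B : ℝ), ContDiffOn ℝ (⊤ : ℕ∞) B (Set.Iio (0:ℝ)) ∧ (∀ t < (0:ℝ), ‖deriv B t‖ ≤ C_B / Real.sqrt (-t)) ∧ Filter.Tendsto B (nhdsWithin (0:ℝ) (Set.Iio (0:ℝ))) (nhds (0 : EuclideanSpace ℝ (Fin 3))) ∧ Literature.Analysis.FluidPDE.typeIBound (Set.Iio (0:ℝ) ×ˢ Set.univ) (fun t x => v t (x - B t) + deriv B t) (fun t x => q t (x - B t) - inner ℝ (deriv (deriv B) t) x) (fun t x => fderiv ℝ (v t) (x - B t)) < ⊤)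

/-! ### The stubs (registered signatures = the expanded statements on ONE line each) -/

/-- **Stub 1 (M) — Galilean gauge fixing.**  If no inhabitant of the crux body has finite
Albritton–Barker quantity in the GIVEN frame, then none has it in ANY smooth Type-I Galilean frame `B`
ending at the pole: wobble a putative inhabitant by `B` (`Negative.witness_wobble`: the body is invariant,
constants `C ↦ C + C_B`; `H`, `Λ` unchanged) and read the frame predicate as the frame-`0` quantity of the
wobbled triple (`Negative.fderiv_wobbleDrift` identifies the gradient).  Leans on: WitnessWobble.lean,
GalileanKernel.lean (LANDED), Clauses.lean (`frequencyRigidity_iff` repackaging).  CLOSED: landed as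
`Theorems/AdaptedFrequencyFrequencyRigidityFrameNormalisation.lean` (p137350); discharged here by import. -/
theorem stub_frameNormalisation : (¬ ∃ (ν C Λ₀ : ℝ) (v : ℝ → EuclideanSpace ℝ (Fin 3) → EuclideanSpace ℝ (Fin 3)) (q : ℝ → EuclideanSpace ℝ (Fin 3) → ℝ) (K : ℝ → EuclideanSpace ℝ (Fin 3) → ℝ), (0 < ν ∧ Literature.Analysis.FluidPDE.IsClassicalNSSolutionOn (Set.Iio 0) ν 0 v q ∧ (∀ t ∈ Set.Iio (0:ℝ), ∀ x, ‖v t x‖ ≤ C / Real.sqrt (-t)) ∧ ContDiffOn ℝ 2 (Function.uncurry K) (Set.Iio (0:ℝ) ×ˢ Set.univ) ∧ (∀ t ∈ Set.Iio (0:ℝ), ∀ x, 0 < K t x) ∧ (∀ t ∈ Set.Iio (0:ℝ), ∀ x, Literature.Analysis.FluidPDE.timeDerivWithin (Set.Iio (0:ℝ)) K t x + fderiv ℝ (K t) x (v t x) + ν * Laplacian.laplacian (K t) x = 0) ∧ (∀ t ∈ Set.Iio (0:ℝ), ∫ x, K t x = 1) ∧ (∀ φ : EuclideanSpace ℝ (Fin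 3) → ℝ, Continuous φ → (∃ M : ℝ, ∀ x, |φ x| ≤ M) → Filter.Tendsto (fun t => ∫ x, φ x * K t x) (nhdsWithin (0:ℝ) (Set.Iio (0:ℝ))) (nhds (φ (0 : EuclideanSpace ℝ (Fin 3))))) ∧ (∃ c₁ c₂ C₁ C₂ : ℝ, 0 < c₁ ∧ 0 < c₂ ∧ 0 < C₁ ∧ 0 < C₂ ∧ ∀ t ∈ Set.Iio (0:ℝ), ∀ x, c₁ * ((0:ℝ) - t) ^ (-(3:ℝ) / 2) * Real.exp (-(‖x - (0 : EuclideanSpace ℝ (Fin 3))‖ ^ 2) / (c₂ * ((0:ℝ) - t))) ≤ K t x ∧ K t x ≤ C₁ * ((0:ℝ) - t) ^ (-(3:ℝ) / 2) * Real.exp (-(‖x - (0 : EuclideanSpace ℝ (Fin 3))‖ ^ 2) / (C₂ * ((0:ℝ) - t)))) ∧ (∀ H Λ : ℝ → ℝ, H = (fun t => ∫ x, ‖Literature.Analysis.FluidPDE.curl (v t) x‖ ^ 2 * K t x) → Λ = (fun t => (0 - t) * deriv H t / H t) → (∀ t ∈ Set.Iio (0:ℝ), 0 < H t) ∧ (∀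 t ∈ Set.Iio (0:ℝ), Λ t = Λ₀))) ∧ Literature.Analysis.FluidPDE.typeIBound (Set.Iio (0:ℝ) ×ˢ Set.univ) v q (fun t x => fderiv ℝ (v t) x) < ⊤) → (¬ ∃ (ν C Λ₀ : ℝ) (v : ℝ → EuclideanSpace ℝ (Fin 3) → EuclideanSpace ℝ (Fin 3)) (q : ℝ → EuclideanSpace ℝ (Fin 3) → ℝ) (K : ℝ → EuclideanSpace ℝ (Fin 3) → ℝ), (0 < ν ∧ Literature.Analysis.FluidPDE.IsClassicalNSSolutionOn (Set.Iio 0) ν 0 v q ∧ (∀ t ∈ Set.Iio (0:ℝ), ∀ x, ‖v t x‖ ≤ C / Real.sqrt (-t)) ∧ ContDiffOn ℝ 2 (Function.uncurry K) (Set.Iio (0:ℝ) ×ˢ Set.univ) ∧ (∀ t ∈ Set.Iio (0:ℝ), ∀ x, 0 < K t x) ∧ (∀ t ∈ Set.Iio (0:ℝ), ∀ x, Literature.Analysis.FluidPDE.timeDerivWithin (Set.Iio (0:ℝ)) K t x + fderiv ℝ (K t) x (v t x) + ν * Laplacian.laplacian (K t) x = 0) ∧ (∀ t ∈ Set.Iio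 (0:ℝ), ∫ x, K t x = 1) ∧ (∀ φ : EuclideanSpace ℝ (Fin 3) → ℝ, Continuous φ → (∃ M : ℝ, ∀ x, |φ x| ≤ M) → Filter.Tendsto (fun t => ∫ x, φ x * K t x) (nhdsWithin (0:ℝ) (Set.Iio (0:ℝ))) (nhds (φ (0 : EuclideanSpace ℝ (Fin 3))))) ∧ (∃ c₁ c₂ C₁ C₂ : ℝ, 0 < c₁ ∧ 0 < c₂ ∧ 0 < C₁ ∧ 0 < C₂ ∧ ∀ t ∈ Set.Iio (0:ℝ), ∀ x, c₁ * ((0:ℝ) - t) ^ (-(3:ℝ) / 2) * Real.exp (-(‖x - (0 : EuclideanSpace ℝ (Fin 3))‖ ^ 2) / (c₂ * ((0:ℝ) - t))) ≤ K t x ∧ K t x ≤ C₁ * ((0:ℝ) - t) ^ (-(3:ℝ) / 2) * Real.exp (-(‖x - (0 : EuclideanSpace ℝ (Fin 3))‖ ^ 2) / (C₂ * ((0:ℝ) - t)))) ∧ (∀ H Λ : ℝ → ℝ, H = (fun t => ∫ x, ‖Literature.Analysis.FluidPDE.curl (v t) x‖ ^ 2 * K t x) → Λ = (fun t => (0 -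 t) * deriv H t / H t) → (∀ t ∈ Set.Iio (0:ℝ), 0 < H t) ∧ (∀ t ∈ Set.Iio (0:ℝ), Λ t = Λ₀))) ∧ (∃ (B : ℝ → EuclideanSpace ℝ (Fin 3)) (C_B : ℝ), ContDiffOn ℝ (⊤ : ℕ∞) B (Set.Iio (0:ℝ)) ∧ (∀ t < (0:ℝ), ‖deriv B t‖ ≤ C_B / Real.sqrt (-t)) ∧ Filter.Tendsto B (nhdsWithin (0:ℝ) (Set.Iio (0:ℝ))) (nhds (0 : EuclideanSpace ℝ (Fin 3))) ∧ Literature.Analysis.FluidPDE.typeIBound (Set.Iio (0:ℝ) ×ˢ Set.univ) (fun t x => v t (x - B t) + deriv B t) (fun t x => q t (x - B t) - inner ℝ (deriv (deriv B) t) x) (fun t x => fderiv ℝ (v t) (x - B t)) < ⊤)) :=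
  Summit.NavierStokesRegularity.NavierStokesRegularity.Theorems.FrequencyRigidity.ScaledEnergySplit.stub_frameNormalisation

/-- **Stub 2′ (XL, held by the lead; THE finite child in Albritton–Barker form).**  No inhabitant of the crux body
admitting a pressure `ϖ` and a weak spatial gradient `G'` for which `(v, ϖ)` is a suitable weak solution of the
viscosity-`ν` system on the slab `ℝ³ × ℝ₋` with `typeIBound (ℝ₋ × ℝ³) v ϖ G' < ⊤`.  This is EXACTLY what the
strengthened transfer `tangentFlowTransfer_finiteAB` delivers for tangent flows, and at `ν = 1` exactly the class of
stmt-1588 `NoTypeIRateProfile`.  Stub 2′ ⇒ Stub 2 (`finiteAB_stub2_of_stub2AB`: classical ⇒ suitable with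
`G' = ∇v`); the converse is the routine pressure identification (not formalised).  Open core: Pineau–Vicol 2026
Conj. 1.1 on its window (leads c6–c8). -/
theorem stub_finiteScaledEnergyLiouvilleAB : ¬ ∃ (ν C Λ₀ : ℝ) (v : ℝ → EuclideanSpace ℝ (Fin 3) → EuclideanSpace ℝ (Fin 3)) (q : ℝ → EuclideanSpace ℝ (Fin 3) → ℝ) (K : ℝ → EuclideanSpace ℝ (Fin 3) → ℝ), (0 < ν ∧ Literature.Analysis.FluidPDE.IsClassicalNSSolutionOn (Set.Iio 0) ν 0 v q ∧ (∀ t ∈ Set.Iio (0:ℝ), ∀ x, ‖v t x‖ ≤ C / Real.sqrt (-t)) ∧ ContDiffOn ℝ 2 (Function.uncurry K) (Set.Iio (0:ℝ) ×ˢ Set.univ) ∧ (∀ t ∈ Set.Iio (0:ℝ), ∀ x, 0 < K t x) ∧ (∀ t ∈ Set.Iio (0:ℝ), ∀ x, Literature.Analysis.FluidPDE.timeDerivWithin (Set.Iio (0:ℝ)) K t x + fderiv ℝ (K t) x (v t x) + ν * Laplacian.laplacian (K t) x = 0) ∧ (∀ t ∈ Set.Iio (0:ℝ), ∫ x, K t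 x = 1) ∧ (∀ φ : EuclideanSpace ℝ (Fin 3) → ℝ, Continuous φ → (∃ M : ℝ, ∀ x, |φ x| ≤ M) → Filter.Tendsto (fun t => ∫ x, φ x * K t x) (nhdsWithin (0:ℝ) (Set.Iio (0:ℝ))) (nhds (φ (0 : EuclideanSpace ℝ (Fin 3))))) ∧ (∃ c₁ c₂ C₁ C₂ : ℝ, 0 < c₁ ∧ 0 < c₂ ∧ 0 < C₁ ∧ 0 < C₂ ∧ ∀ t ∈ Set.Iio (0:ℝ), ∀ x, c₁ * ((0:ℝ) - t) ^ (-(3:ℝ) / 2) * Real.exp (-(‖x - (0 : EuclideanSpace ℝ (Fin 3))‖ ^ 2) / (c₂ * ((0:ℝ) - t))) ≤ K t x ∧ K t x ≤ C₁ * ((0:ℝ) - t) ^ (-(3:ℝ) / 2) * Real.exp (-(‖x - (0 : EuclideanSpace ℝ (Fin 3))‖ ^ 2) / (C₂ * ((0:ℝ) - t)))) ∧ (∀ H Λ : ℝ → ℝ, H = (fun t => ∫ x, ‖Literature.Analysis.FluidPDE.curl (v t) x‖ ^ 2 * K t x) → Λ = (fun t => (0 - t) * deriv H t / H t) → (∀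 t ∈ Set.Iio (0:ℝ), 0 < H t) ∧ (∀ t ∈ Set.Iio (0:ℝ), Λ t = Λ₀))) ∧ (∃ (ϖ : ℝ → EuclideanSpace ℝ (Fin 3) → ℝ) (G' : ℝ → EuclideanSpace ℝ (Fin 3) → EuclideanSpace ℝ (Fin 3) →L[ℝ] EuclideanSpace ℝ (Fin 3)), Literature.Analysis.FluidPDE.IsSuitableWeakSolutionOn (Literature.Analysis.FluidPDE.slab (EuclideanSpace ℝ (Fin 3)) (Set.Iio 0) isOpen_Iio) ν 0 v ϖ ∧ Literature.Analysis.FluidPDE.HasWeakSpatialGradientOn (Literature.Analysis.FluidPDE.slab (EuclideanSpace ℝ (Fin 3)) (Set.Iio 0) isOpen_Iio) v G' ∧ Literature.Analysis.FluidPDE.typeIBound (Set.Iio (0:ℝ) ×ˢ Set.univ) v ϖ G' < ⊤) := by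
  sorry

/-- **Stub 2 (XL, the piece the route needs) — flat Liouville in the Albritton–Barker class.**  No
inhabitant of the crux body (classical ancient NS, GLOBAL time-Type-I bound, adapted Gaussian-comparable
kernel at the pole, `H > 0`, `Λ` constant — hence `H = A(−t)⁻²`) with `typeIBound (ℝ₋ × ℝ³) v q ∇v < ⊤`.
Upper bounds (tree): ⇐ stmt-4050 via p121984; ⇐ stmt-1588 `NoTypeIRateProfile` by ν-normalisation +
classical ⇒ suitable + (flat ⇒ `(0,0)` backward-singular; lead c6 leaf).  Axisymmetric case: CLOSABLE by
`axisymmetricTypeIExclusion_of_tree`.  Lower bound: ⊇ rotated-self-similar Liouville for Morrey-decaying bounded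
profiles, every `α ≠ 0`; the window `α ∈ [α₁, α₂]` is Pineau–Vicol 2026 Conj. 1.1 (OPEN). -/
theorem stub_finiteScaledEnergyLiouville : ¬ ∃ (ν C Λ₀ : ℝ) (v : ℝ → EuclideanSpace ℝ (Fin 3) → EuclideanSpace ℝ (Fin 3)) (q : ℝ → EuclideanSpace ℝ (Fin 3) → ℝ) (K : ℝ → EuclideanSpace ℝ (Fin 3) → ℝ), (0 < ν ∧ Literature.Analysis.FluidPDE.IsClassicalNSSolutionOn (Set.Iio 0) ν 0 v q ∧ (∀ t ∈ Set.Iio (0:ℝ), ∀ x, ‖v t x‖ ≤ C / Real.sqrt (-t)) ∧ ContDiffOn ℝ 2 (Function.uncurry K) (Set.Iio (0:ℝ) ×ˢ Set.univ) ∧ (∀ t ∈ Set.Iio (0:ℝ), ∀ x, 0 < K t x) ∧ (∀ t ∈ Set.Iio (0:ℝ), ∀ x, Literature.Analysis.FluidPDE.timeDerivWithin (Set.Iio (0:ℝ)) K t x + fderiv ℝ (K t) x (v t x) + ν * Laplacian.laplacian (K t) x = 0) ∧ (∀ t ∈ Set.Iio (0:ℝ), ∫ x, K t x = 1) ∧ (∀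 φ : EuclideanSpace ℝ (Fin 3) → ℝ, Continuous φ → (∃ M : ℝ, ∀ x, |φ x| ≤ M) → Filter.Tendsto (fun t => ∫ x, φ x * K t x) (nhdsWithin (0:ℝ) (Set.Iio (0:ℝ))) (nhds (φ (0 : EuclideanSpace ℝ (Fin 3))))) ∧ (∃ c₁ c₂ C₁ C₂ : ℝ, 0 < c₁ ∧ 0 < c₂ ∧ 0 < C₁ ∧ 0 < C₂ ∧ ∀ t ∈ Set.Iio (0:ℝ), ∀ x, c₁ * ((0:ℝ) - t) ^ (-(3:ℝ) / 2) * Real.exp (-(‖x - (0 : EuclideanSpace ℝ (Fin 3))‖ ^ 2) / (c₂ * ((0:ℝ) - t))) ≤ K t x ∧ K t x ≤ C₁ * ((0:ℝ) - t) ^ (-(3:ℝ) / 2) * Real.exp (-(‖x - (0 : EuclideanSpace ℝ (Fin 3))‖ ^ 2) / (C₂ * ((0:ℝ) - t)))) ∧ (∀ H Λ : ℝ → ℝ, H = (fun t => ∫ x, ‖Literature.Analysis.FluidPDE.curl (v t) x‖ ^ 2 * K t x) → Λ = (fun t => (0 - t) * deriv H t / H t) → (∀ t ∈ Set.Iio (0:ℝ),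 0 < H t) ∧ (∀ t ∈ Set.Iio (0:ℝ), Λ t = Λ₀))) ∧ Literature.Analysis.FluidPDE.typeIBound (Set.Iio (0:ℝ) ×ˢ Set.univ) v q (fun t x => fderiv ℝ (v t) x) < ⊤ :=
  Summit.NavierStokesRegularity.NavierStokesRegularity.Theorems.finiteAB_stub2_of_stub2AB stub_finiteScaledEnergyLiouvilleAB

/-- **Stub 3 (XL, route-irrelevant, DO NOT STAFF) — the non-decaying core.**  No inhabitant of the crux
body whose Albritton–Barker quantity is infinite in EVERY smooth Type-I Galilean frame ending at the pole.
Contains bounded NON-decaying RSS-Liouville for every `α ≠ 0` (beyond even PV Conj. 1.1's decaying class).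
The route never produces such an object (tangent flows have `𝐈 < ⊤`): the tenure planner should restate
`closes` to consume the finite piece and drop this one; until then it stands here so that
`FrequencyRigidity_of` is honest. -/
theorem stub_infiniteScaledEnergyLiouville : ¬ ∃ (ν C Λ₀ : ℝ) (v : ℝ → EuclideanSpace ℝ (Fin 3) → EuclideanSpace ℝ (Fin 3)) (q : ℝ → EuclideanSpace ℝ (Fin 3) → ℝ) (K : ℝ → EuclideanSpace ℝ (Fin 3) → ℝ), (0 < ν ∧ Literature.Analysis.FluidPDE.IsClassicalNSSolutionOn (Set.Iio 0) ν 0 v q ∧ (∀ t ∈ Set.Iio (0:ℝ), ∀ x, ‖v t x‖ ≤ C / Real.sqrt (-t)) ∧ ContDiffOn ℝ 2 (Function.uncurry K) (Set.Iio (0:ℝ) ×ˢ Set.univ) ∧ (∀ t ∈ Set.Iio (0:ℝ), ∀ x, 0 < K t x) ∧ (∀ t ∈ Set.Iio (0:ℝ), ∀ x, Literature.Analysis.FluidPDE.timeDerivWithin (Set.Iio (0:ℝ)) K t x + fderiv ℝ (K t) x (v t x) + ν * Laplacian.laplacian (K t) x = 0) ∧ (∀ t ∈ Set.Iio (0:ℝ),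 ∫ x, K t x = 1) ∧ (∀ φ : EuclideanSpace ℝ (Fin 3) → ℝ, Continuous φ → (∃ M : ℝ, ∀ x, |φ x| ≤ M) → Filter.Tendsto (fun t => ∫ x, φ x * K t x) (nhdsWithin (0:ℝ) (Set.Iio (0:ℝ))) (nhds (φ (0 : EuclideanSpace ℝ (Fin 3))))) ∧ (∃ c₁ c₂ C₁ C₂ : ℝ, 0 < c₁ ∧ 0 < c₂ ∧ 0 < C₁ ∧ 0 < C₂ ∧ ∀ t ∈ Set.Iio (0:ℝ), ∀ x, c₁ * ((0:ℝ) - t) ^ (-(3:ℝ) / 2) * Real.exp (-(‖x - (0 : EuclideanSpace ℝ (Fin 3))‖ ^ 2) / (c₂ * ((0:ℝ) - t))) ≤ K t x ∧ K t x ≤ C₁ * ((0:ℝ) - t) ^ (-(3:ℝ) / 2) * Real.exp (-(‖x - (0 : EuclideanSpace ℝ (Fin 3))‖ ^ 2) / (C₂ * ((0:ℝ) - t)))) ∧ (∀ H Λ : ℝ → ℝ, H = (fun t => ∫ x, ‖Literature.Analysis.FluidPDE.curl (v t) x‖ ^ 2 * K t x) → Λ = (fun t => (0 - t) * deriv H t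 / H t) → (∀ t ∈ Set.Iio (0:ℝ), 0 < H t) ∧ (∀ t ∈ Set.Iio (0:ℝ), Λ t = Λ₀))) ∧ ¬ (∃ (B : ℝ → EuclideanSpace ℝ (Fin 3)) (C_B : ℝ), ContDiffOn ℝ (⊤ : ℕ∞) B (Set.Iio (0:ℝ)) ∧ (∀ t < (0:ℝ), ‖deriv B t‖ ≤ C_B / Real.sqrt (-t)) ∧ Filter.Tendsto B (nhdsWithin (0:ℝ) (Set.Iio (0:ℝ))) (nhds (0 : EuclideanSpace ℝ (Fin 3))) ∧ Literature.Analysis.FluidPDE.typeIBound (Set.Iio (0:ℝ) ×ˢ Set.univ) (fun t x => v t (x - B t) + deriv B t) (fun t x => q t (x - B t) - inner ℝ (deriv (deriv B) t) x) (fun t x => fderiv ℝ (v t) (x - B t)) < ⊤) := by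
  sorry

/-! ### Composition -/

/-- **Composition** — the three stubs give the crux BY NAME: gauge-fix the finite piece (Stub 1 ∘ Stub 2),
then excluded middle on the frame predicate against Stub 3.  Sorry-free. -/
theorem FrequencyRigidity_of (hN : Sig.stub_frameNormalisation) (h0 : Sig.stub_finiteScaledEnergyLiouville)
    (h2 : Sig.stub_infiniteScaledEnergyLiouville) :
    Summit.NavierStokesRegularity.NavierStokesRegularity.Theses.AdaptedFrequency.FrequencyRigidity := by
  have h1 : Sig.finiteScaledEnergyPiece := hN h0
  unfold Sig.finiteScaledEnergyPiece at h1
  unfold Sig.stub_infiniteScaledEnergyLiouville at h2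
  unfold Summit.NavierStokesRegularity.NavierStokesRegularity.Theses.AdaptedFrequency.FrequencyRigidity
  rintro ⟨ν, C, Λ₀, v, q, K, hbody⟩
  by_cases hP : ∃ (B : ℝ → EuclideanSpace ℝ (Fin 3)) (C_B : ℝ), ContDiffOn ℝ (⊤ : ℕ∞) B (Set.Iio (0:ℝ)) ∧ (∀ t < (0:ℝ), ‖deriv B t‖ ≤ C_B / Real.sqrt (-t)) ∧ Filter.Tendsto B (nhdsWithin (0:ℝ) (Set.Iio (0:ℝ))) (nhds (0 : EuclideanSpace ℝ (Fin 3))) ∧ Literature.Analysis.FluidPDE.typeIBound (Set.Iio (0:ℝ) ×ˢ Set.univ) (fun t x => v t (x - B t) + deriv B t) (fun t x => q t (x - B t) - inner ℝ (deriv (deriv B) t) x) (fun t x => fderiv ℝ (v t) (x - B t)) < ⊤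
  · exact h1 ⟨ν, C, Λ₀, v, q, K, hbody, hP⟩
  · exact h2 ⟨ν, C, Λ₀, v, q, K, hbody, hP⟩

/-- The skeleton instantiated: the crux modulo the three registered stubs (the expanded statements are
definitionally the `Sig.*` abbreviations). -/
theorem FrequencyRigidity_skeleton :
    Summit.NavierStokesRegularity.NavierStokesRegularity.Theses.AdaptedFrequency.FrequencyRigidity :=
  FrequencyRigidity_of stub_frameNormalisation stub_finiteScaledEnergyLiouville stub_infiniteScaledEnergyLiouville

/-- **Composition through the Albritton–Barker form (lead c9)**: Stub 2′ and Stub 3 give the crux BY NAME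
(landed glue `frequencyRigidity_of_stub2AB_of_stub3` = Stub 1 ∘ (Stub 2 ⇐ Stub 2′) + excluded middle). -/
theorem FrequencyRigidity_skeleton_AB :
    Summit.NavierStokesRegularity.NavierStokesRegularity.Theses.AdaptedFrequency.FrequencyRigidity :=
  Summit.NavierStokesRegularity.NavierStokesRegularity.Theorems.frequencyRigidity_of_stub2AB_of_stub3
    stub_finiteScaledEnergyLiouvilleAB stub_infiniteScaledEnergyLiouville

/-! ### What the ROUTE needs after lead c9: only Stub 2′ (the enabler is in the tree) -/

/-- **The route closes modulo Stub 2′ alone (plus the route's other open items `AdaptedFrequencyConverges`, `NoTypeII`).**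
Landed chain: `finiteAB_navierStokesRegularity_of_finiteChild` (glue-2) = `finiteAB_closes` (p155905) fed with the ENABLER
`tangentFlowTransfer_finiteAB` (p156069) and the PROVED items `AdaptedKernelExists`, `SingularPointExists`, `NoBlowupToClay`.
Stub 3 is not used: the planner may restate `closes` to consume Stub 2′ and drop the infinite child (R1). -/
theorem route_closes_of_stub2AB
    (hAFC : Summit.NavierStokesRegularity.NavierStokesRegularity.Theses.AdaptedFrequency.AdaptedFrequencyConverges)
    (hNT2 : Summit.NavierStokesRegularity.NavierStokesRegularity.Theses.AdaptedFrequency.NoTypeII) :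
    NavierStokesRegularity :=
  Summit.NavierStokesRegularity.NavierStokesRegularity.Theorems.finiteAB_navierStokesRegularity_of_finiteChild hAFC
    stub_finiteScaledEnergyLiouvilleAB hNT2

/-- **Stub 2′ ⇐ stmt-1588** (glue-2 `finiteAB_stub2AB_of_noTypeIRateProfile`): the A–B form of the finite child is implied by the
target `NoTypeIRateProfile` of routes RecurrentProfiles / DulacContraction (viscosity normalisation of the A–B clause, flat ⇒
backward-singular pole) — the dedup recommendation R2 made checkable. -/
theorem stub2AB_of_noTypeIRateProfile
    (h : Summit.NavierStokesRegularity.NavierStokesRegularity.Theses.RecurrentProfiles.NoTypeIRateProfile) :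
    ¬ ∃ (ν C Λ₀ : ℝ) (v : ℝ → EuclideanSpace ℝ (Fin 3) → EuclideanSpace ℝ (Fin 3)) (q : ℝ → EuclideanSpace ℝ (Fin 3) → ℝ) (K : ℝ → EuclideanSpace ℝ (Fin 3) → ℝ), (0 < ν ∧ Literature.Analysis.FluidPDE.IsClassicalNSSolutionOn (Set.Iio 0) ν 0 v q ∧ (∀ t ∈ Set.Iio (0:ℝ), ∀ x, ‖v t x‖ ≤ C / Real.sqrt (-t)) ∧ ContDiffOn ℝ 2 (Function.uncurry K) (Set.Iio (0:ℝ) ×ˢ Set.univ) ∧ (∀ t ∈ Set.Iio (0:ℝ), ∀ x, 0 < K t x) ∧ (∀ t ∈ Set.Iio (0:ℝ), ∀ x, Literature.Analysis.FluidPDE.timeDerivWithin (Set.Iio (0:ℝ)) K t x + fderiv ℝ (K t) x (v t x) + ν * Laplacian.laplacian (K t) x = 0) ∧ (∀ t ∈ Set.Iio (0:ℝ), ∫ x, K t x = 1) ∧ (∀ φ : EuclideanSpace ℝ (Fin 3) → ℝ, Continuous φ → (∃ M : ℝ, ∀ x, |φ x| ≤ M) → Filter.Tendsto (fun t => ∫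 x, φ x * K t x) (nhdsWithin (0:ℝ) (Set.Iio (0:ℝ))) (nhds (φ (0 : EuclideanSpace ℝ (Fin 3))))) ∧ (∃ c₁ c₂ C₁ C₂ : ℝ, 0 < c₁ ∧ 0 < c₂ ∧ 0 < C₁ ∧ 0 < C₂ ∧ ∀ t ∈ Set.Iio (0:ℝ), ∀ x, c₁ * ((0:ℝ) - t) ^ (-(3:ℝ) / 2) * Real.exp (-(‖x - (0 : EuclideanSpace ℝ (Fin 3))‖ ^ 2) / (c₂ * ((0:ℝ) - t))) ≤ K t x ∧ K t x ≤ C₁ * ((0:ℝ) - t) ^ (-(3:ℝ) / 2) * Real.exp (-(‖x - (0 : EuclideanSpace ℝ (Fin 3))‖ ^ 2) / (C₂ * ((0:ℝ) - t)))) ∧ (∀ H Λ : ℝ → ℝ, H = (fun t => ∫ x, ‖Literature.Analysis.FluidPDE.curl (v t) x‖ ^ 2 * K t x) → Λ = (fun t => (0 - t) * deriv H t / H t) → (∀ t ∈ Set.Iio (0:ℝ), 0 < H t) ∧ (∀ t ∈ Set.Iio (0:ℝ), Λ t = Λ₀))) ∧ (∃ (ϖ : ℝ → EuclideanSpace ℝ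 (Fin 3) → ℝ) (G' : ℝ → EuclideanSpace ℝ (Fin 3) → EuclideanSpace ℝ (Fin 3) →L[ℝ] EuclideanSpace ℝ (Fin 3)), Literature.Analysis.FluidPDE.IsSuitableWeakSolutionOn (Literature.Analysis.FluidPDE.slab (EuclideanSpace ℝ (Fin 3)) (Set.Iio 0) isOpen_Iio) ν 0 v ϖ ∧ Literature.Analysis.FluidPDE.HasWeakSpatialGradientOn (Literature.Analysis.FluidPDE.slab (EuclideanSpace ℝ (Fin 3)) (Set.Iio 0) isOpen_Iio) v G' ∧ Literature.Analysis.FluidPDE.typeIBound (Set.Iio (0:ℝ) ×ˢ Set.univ) v ϖ G' < ⊤) :=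
  Summit.NavierStokesRegularity.NavierStokesRegularity.Theorems.finiteAB_stub2AB_of_noTypeIRateProfile h

/-- **Stub 2′ ⇐ stmt-1589 `RecurrentLiouville`** (glue-2 `finiteAB_stub2AB_of_recurrentLiouville'`, using the PROVED
`RecurrentReduction` stmt-1590): the recurrent Liouville crux of route RecurrentProfiles implies the finite child. -/
theorem stub2AB_of_recurrentLiouville
    (h : Summit.NavierStokesRegularity.NavierStokesRegularity.Theses.RecurrentProfiles.RecurrentLiouville) :
    ¬ ∃ (ν C Λ₀ : ℝ) (v : ℝ → EuclideanSpace ℝ (Fin 3) → EuclideanSpace ℝ (Fin 3)) (q : ℝ → EuclideanSpace ℝ (Fin 3) → ℝ) (K : ℝ → EuclideanSpace ℝ (Fin 3) → ℝ), (0 < ν ∧ Literature.Analysis.FluidPDE.IsClassicalNSSolutionOn (Set.Iio 0) ν 0 v q ∧ (∀ t ∈ Set.Iio (0:ℝ), ∀ x, ‖v t x‖ ≤ C / Real.sqrt (-t)) ∧ ContDiffOn ℝ 2 (Function.uncurry K) (Set.Iio (0:ℝ) ×ˢ Set.univ) ∧ (∀ t ∈ Set.Iio (0:ℝ), ∀ x,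 0 < K t x) ∧ (∀ t ∈ Set.Iio (0:ℝ), ∀ x, Literature.Analysis.FluidPDE.timeDerivWithin (Set.Iio (0:ℝ)) K t x + fderiv ℝ (K t) x (v t x) + ν * Laplacian.laplacian (K t) x = 0) ∧ (∀ t ∈ Set.Iio (0:ℝ), ∫ x, K t x = 1) ∧ (∀ φ : EuclideanSpace ℝ (Fin 3) → ℝ, Continuous φ → (∃ M : ℝ, ∀ x, |φ x| ≤ M) → Filter.Tendsto (fun t => ∫ x, φ x * K t x) (nhdsWithin (0:ℝ) (Set.Iio (0:ℝ))) (nhds (φ (0 : EuclideanSpace ℝ (Fin 3))))) ∧ (∃ c₁ c₂ C₁ C₂ : ℝ, 0 < c₁ ∧ 0 < c₂ ∧ 0 < C₁ ∧ 0 < C₂ ∧ ∀ t ∈ Set.Iio (0:ℝ), ∀ x, c₁ * ((0:ℝ) - t) ^ (-(3:ℝ) / 2) * Real.exp (-(‖x - (0 : EuclideanSpace ℝ (Fin 3))‖ ^ 2) / (c₂ * ((0:ℝ) - t))) ≤ K t x ∧ K t x ≤ C₁ * ((0:ℝ) - t) ^ (-(3:ℝ) / 2) * Real.exp (-(‖x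 - (0 : EuclideanSpace ℝ (Fin 3))‖ ^ 2) / (C₂ * ((0:ℝ) - t)))) ∧ (∀ H Λ : ℝ → ℝ, H = (fun t => ∫ x, ‖Literature.Analysis.FluidPDE.curl (v t) x‖ ^ 2 * K t x) → Λ = (fun t => (0 - t) * deriv H t / H t) → (∀ t ∈ Set.Iio (0:ℝ), 0 < H t) ∧ (∀ t ∈ Set.Iio (0:ℝ), Λ t = Λ₀))) ∧ (∃ (ϖ : ℝ → EuclideanSpace ℝ (Fin 3) → ℝ) (G' : ℝ → EuclideanSpace ℝ (Fin 3) → EuclideanSpace ℝ (Fin 3) →L[ℝ] EuclideanSpace ℝ (Fin 3)), Literature.Analysis.FluidPDE.IsSuitableWeakSolutionOn (Literature.Analysis.FluidPDE.slab (EuclideanSpace ℝ (Fin 3)) (Set.Iio 0) isOpen_Iio) ν 0 v ϖ ∧ Literature.Analysis.FluidPDE.HasWeakSpatialGradientOn (Literature.Analysis.FluidPDE.slab (EuclideanSpace ℝ (Fin 3)) (Set.Iio 0) isOpen_Iio) v G' ∧ Literature.Analysis.FluidPDE.typeIBound (Set.Iio (0:ℝ) ×ˢ Set.univ) v ϖ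 G' < ⊤) :=
  Summit.NavierStokesRegularity.NavierStokesRegularity.Theorems.finiteAB_stub2AB_of_recurrentLiouville' h

/-! ### The partial-results dictionary of Stub 2′ (lead c9, wave 3): the c6/c7 leaves ported to the A–B form

After the planner's R1 restatement the crux IS Stub 2′; these three landed theorems make its known cases tree theorems in
its own vocabulary (suitable pressure `ϖ`, weak gradient `G'`): the axisymmetric case is CLOSED, small scaled energy is
excluded, and every rotated-self-similar witness has a Pineau–Vicol-decaying profile (so, with `rss_witness_in_window` and
`pvConjecture_of_stub2' ∘ finiteAB_stub2_of_stub2AB`, the RSS content of Stub 2′ is PV Conj. 1.1 on its window, exactly). -/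

/-- **No axisymmetric witness of Stub 2′** (landed `finiteAB_axisymmetricLeaf`, p157347; core `finiteAB_axisymmetricCore_unit` =
Seregin–Šverák 2009 Thm 3.1 in the A–B class, via the tree's `rlAxisymRegular_of_repr`). -/
theorem stub2AB_axisymmetric : ∀ (ν C Λ₀ : ℝ) (v : ℝ → EuclideanSpace ℝ (Fin 3) → EuclideanSpace ℝ (Fin 3)) (q : ℝ → EuclideanSpace ℝ (Fin 3) → ℝ) (K : ℝ → EuclideanSpace ℝ (Fin 3) → ℝ), (0 < ν ∧ Literature.Analysis.FluidPDE.IsClassicalNSSolutionOn (Set.Iio 0) ν 0 v q ∧ (∀ t ∈ Set.Iio (0:ℝ), ∀ x, ‖v t x‖ ≤ C / Real.sqrt (-t)) ∧ ContDiffOn ℝ 2 (Function.uncurry K) (Set.Iio (0:ℝ) ×ˢ Set.univ) ∧ (∀ t ∈ Set.Iio (0:ℝ), ∀ x, 0 < K t x) ∧ (∀ t ∈ Set.Iio (0:ℝ), ∀ x, Literature.Analysis.FluidPDE.timeDerivWithin (Set.Iio (0:ℝ)) K t x + fderiv ℝ (K t) x (v t x) + ν * Laplacian.laplacian (K t) x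 = 0) ∧ (∀ t ∈ Set.Iio (0:ℝ), ∫ x, K t x = 1) ∧ (∀ φ : EuclideanSpace ℝ (Fin 3) → ℝ, Continuous φ → (∃ M : ℝ, ∀ x, |φ x| ≤ M) → Filter.Tendsto (fun t => ∫ x, φ x * K t x) (nhdsWithin (0:ℝ) (Set.Iio (0:ℝ))) (nhds (φ (0 : EuclideanSpace ℝ (Fin 3))))) ∧ (∃ c₁ c₂ C₁ C₂ : ℝ, 0 < c₁ ∧ 0 < c₂ ∧ 0 < C₁ ∧ 0 < C₂ ∧ ∀ t ∈ Set.Iio (0:ℝ), ∀ x, c₁ * ((0:ℝ) - t) ^ (-(3:ℝ) / 2) * Real.exp (-(‖x - (0 : EuclideanSpace ℝ (Fin 3))‖ ^ 2) / (c₂ * ((0:ℝ) - t))) ≤ K t x ∧ K t x ≤ C₁ * ((0:ℝ) - t) ^ (-(3:ℝ) / 2) * Real.exp (-(‖x - (0 : EuclideanSpace ℝ (Fin 3))‖ ^ 2) / (C₂ * ((0:ℝ) - t)))) ∧ (∀ H Λ : ℝ → ℝ, H = (fun t => ∫ x, ‖Literature.Analysis.FluidPDE.curl (v t) x‖ ^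 2 * K t x) → Λ = (fun t => (0 - t) * deriv H t / H t) → (∀ t ∈ Set.Iio (0:ℝ), 0 < H t) ∧ (∀ t ∈ Set.Iio (0:ℝ), Λ t = Λ₀))) → (∃ (ϖ : ℝ → EuclideanSpace ℝ (Fin 3) → ℝ) (G' : ℝ → EuclideanSpace ℝ (Fin 3) → EuclideanSpace ℝ (Fin 3) →L[ℝ] EuclideanSpace ℝ (Fin 3)), Literature.Analysis.FluidPDE.IsSuitableWeakSolutionOn (Literature.Analysis.FluidPDE.slab (EuclideanSpace ℝ (Fin 3)) (Set.Iio 0) isOpen_Iio) ν 0 v ϖ ∧ Literature.Analysis.FluidPDE.HasWeakSpatialGradientOn (Literature.Analysis.FluidPDE.slab (EuclideanSpace ℝ (Fin 3)) (Set.Iio 0) isOpen_Iio) v G' ∧ Literature.Analysis.FluidPDE.typeIBound (Set.Iio (0:ℝ) ×ˢ Set.univ) v ϖ G' < ⊤) → (∀ t ∈ Set.Iio (0:ℝ), Literature.Analysis.FluidPDE.IsAxisymmetric (v t)) → False :=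
  Summit.NavierStokesRegularity.NavierStokesRegularity.Theorems.finiteAB_axisymmetricLeaf

/-- **The small-scaled-energy gap of Stub 2′** at unit viscosity (landed `finiteAB_smallScaledEnergyGap`, p157528; core
`finiteAB_smallScaledEnergyRegular` = Seregin's ε-regularity in the A–B slab class). -/
theorem stub2AB_smallScaledEnergyGap : ∃ ε : ℝ, 0 < ε ∧ ∀ (C Λ₀ : ℝ) (v : ℝ → EuclideanSpace ℝ (Fin 3) → EuclideanSpace ℝ (Fin 3)) (q : ℝ → EuclideanSpace ℝ (Fin 3) → ℝ) (K : ℝ → EuclideanSpace ℝ (Fin 3) → ℝ), (Literature.Analysis.FluidPDE.IsClassicalNSSolutionOn (Set.Iio 0) 1 0 v q ∧ (∀ t ∈ Set.Iio (0:ℝ), ∀ x, ‖v t x‖ ≤ C / Real.sqrt (-t)) ∧ ContDiffOn ℝ 2 (Function.uncurry K) (Set.Iio (0:ℝ) ×ˢ Set.univ) ∧ (∀ t ∈ Set.Iio (0:ℝ), ∀ x, 0 < K t x) ∧ (∀ t ∈ Set.Iio (0:ℝ), ∀ x, Literature.Analysis.FluidPDE.timeDerivWithin (Set.Iio (0:ℝ))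 K t x + fderiv ℝ (K t) x (v t x) + 1 * Laplacian.laplacian (K t) x = 0) ∧ (∀ t ∈ Set.Iio (0:ℝ), ∫ x, K t x = 1) ∧ (∀ φ : EuclideanSpace ℝ (Fin 3) → ℝ, Continuous φ → (∃ M : ℝ, ∀ x, |φ x| ≤ M) → Filter.Tendsto (fun t => ∫ x, φ x * K t x) (nhdsWithin (0:ℝ) (Set.Iio (0:ℝ))) (nhds (φ (0 : EuclideanSpace ℝ (Fin 3))))) ∧ (∃ c₁ c₂ C₁ C₂ : ℝ, 0 < c₁ ∧ 0 < c₂ ∧ 0 < C₁ ∧ 0 < C₂ ∧ ∀ t ∈ Set.Iio (0:ℝ), ∀ x, c₁ * ((0:ℝ) - t) ^ (-(3:ℝ) / 2) * Real.exp (-(‖x - (0 : EuclideanSpace ℝ (Fin 3))‖ ^ 2) / (c₂ * ((0:ℝ) - t))) ≤ K t x ∧ K t x ≤ C₁ * ((0:ℝ) - t) ^ (-(3:ℝ) / 2) * Real.exp (-(‖x - (0 : EuclideanSpace ℝ (Fin 3))‖ ^ 2) / (C₂ * ((0:ℝ) - t)))) ∧ (∀ H Λ : ℝ → ℝ, H =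 (fun t => ∫ x, ‖Literature.Analysis.FluidPDE.curl (v t) x‖ ^ 2 * K t x) → Λ = (fun t => (0 - t) * deriv H t / H t) → (∀ t ∈ Set.Iio (0:ℝ), 0 < H t) ∧ (∀ t ∈ Set.Iio (0:ℝ), Λ t = Λ₀))) → ∀ (ϖ : ℝ → EuclideanSpace ℝ (Fin 3) → ℝ) (G' : ℝ → EuclideanSpace ℝ (Fin 3) → EuclideanSpace ℝ (Fin 3) →L[ℝ] EuclideanSpace ℝ (Fin 3)), Literature.Analysis.FluidPDE.IsSuitableWeakSolutionOn (Literature.Analysis.FluidPDE.slab (EuclideanSpace ℝ (Fin 3)) (Set.Iio 0) isOpen_Iio) 1 0 v ϖ → Literature.Analysis.FluidPDE.HasWeakSpatialGradientOn (Literature.Analysis.FluidPDE.slab (EuclideanSpace ℝ (Fin 3)) (Set.Iio 0) isOpen_Iio) v G' → Literature.Analysis.FluidPDE.typeIBound (Set.Iio (0:ℝ) ×ˢ Set.univ) v ϖ G' < ENNReal.ofReal ε → False :=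
  Summit.NavierStokesRegularity.NavierStokesRegularity.Theorems.finiteAB_smallScaledEnergyGap

/-- **Every rotated-self-similar witness of Stub 2′ has a Pineau–Vicol-decaying profile** (landed `finiteAB_rssWitnessDecays`,
p157940: the top-singular-set argument of Tsai 1998 §4 runs on the SUITABLE triple; the window statement `rss_witness_in_window`
needs no port). -/
theorem stub2AB_rssWitnessDecays : ∀ (ν α : ℝ) (U : EuclideanSpace ℝ (Fin 3) → EuclideanSpace ℝ (Fin 3)) (v : ℝ → EuclideanSpace ℝ (Fin 3) → EuclideanSpace ℝ (Fin 3)) (q : ℝ → EuclideanSpace ℝ (Fin 3) → ℝ) (ϖ : ℝ → EuclideanSpace ℝ (Fin 3) → ℝ) (G' : ℝ → EuclideanSpace ℝ (Fin 3) → EuclideanSpace ℝ (Fin 3) →L[ℝ] EuclideanSpace ℝ (Fin 3)), 0 < ν → Literature.Analysis.FluidPDE.IsClassicalNSSolutionOn (Set.Iio 0) ν 0 v q → (∀ t ∈ Set.Iio (0:ℝ), ∀ x, v t x = Literature.Analysis.FluidPDE.pvAnsatz α (fun y _ => U y) t x) → Literature.Analysis.FluidPDE.IsSuitableWeakSolutionOn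 (Literature.Analysis.FluidPDE.slab (EuclideanSpace ℝ (Fin 3)) (Set.Iio 0) isOpen_Iio) ν 0 v ϖ → Literature.Analysis.FluidPDE.HasWeakSpatialGradientOn (Literature.Analysis.FluidPDE.slab (EuclideanSpace ℝ (Fin 3)) (Set.Iio 0) isOpen_Iio) v G' → Literature.Analysis.FluidPDE.typeIBound (Set.Iio (0:ℝ) ×ˢ Set.univ) v ϖ G' < ⊤ → ∃ C₀ : ℝ, 0 < C₀ ∧ ∀ y, ‖U y‖ ≤ C₀ / (1 + ‖y‖) :=
  Summit.NavierStokesRegularity.NavierStokesRegularity.Theorems.finiteAB_rssWitnessDecays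

/-! ### Bookkeeping for the tenure planner -/

/-- **The route's frame is admissible**: with `B ≡ 0` the frame predicate reduces to
`typeIBound (ℝ₋ × ℝ³) v q ∇v < ⊤` — what a strengthened `TangentFlowTransfer` delivers (A–B Lemma 2.5). -/
theorem framePredicate_of_typeIBound_lt_top
    {v : ℝ → EuclideanSpace ℝ (Fin 3) → EuclideanSpace ℝ (Fin 3)} {q : ℝ → EuclideanSpace ℝ (Fin 3) → ℝ}
    (h : Literature.Analysis.FluidPDE.typeIBound (Set.Iio (0:ℝ) ×ˢ Set.univ) v q
      (fun t x => fderiv ℝ (v t) x) < ⊤) :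
    (∃ (B : ℝ → EuclideanSpace ℝ (Fin 3)) (C_B : ℝ), ContDiffOn ℝ (⊤ : ℕ∞) B (Set.Iio (0:ℝ)) ∧ (∀ t < (0:ℝ), ‖deriv B t‖ ≤ C_B / Real.sqrt (-t)) ∧ Filter.Tendsto B (nhdsWithin (0:ℝ) (Set.Iio (0:ℝ))) (nhds (0 : EuclideanSpace ℝ (Fin 3))) ∧ Literature.Analysis.FluidPDE.typeIBound (Set.Iio (0:ℝ) ×ˢ Set.univ) (fun t x => v t (x - B t) + deriv B t) (fun t x => q t (x - B t) - inner ℝ (deriv (deriv B) t) x) (fun t x => fderiv ℝ (v t) (x - B t)) < ⊤) := by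
  refine ⟨fun _ => 0, 0, contDiffOn_const, ?_, tendsto_const_nhds, ?_⟩
  · intro t ht; simp
  · simpa using h

/-- The converse bookkeeping: the finite piece implies the frame-0 stub (take `B ≡ 0`). -/
theorem stub_finiteScaledEnergyLiouville_of_piece (h : Sig.finiteScaledEnergyPiece) :
    Sig.stub_finiteScaledEnergyLiouville := by
  rintro ⟨ν, C, Λ₀, v, q, K, hbody, hP⟩
  exact h ⟨ν, C, Λ₀, v, q, K, hbody, framePredicate_of_typeIBound_lt_top hP⟩

/-! ### Landed leaves of Stub 2 (lead c6), restated against the skeleton's abbreviations -/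

/-- **Stub 2 ⇐ stmt-1588** (landed `stub_finiteOfNoTypeIRateProfile`, FiniteBridges): the target
`NoTypeIRateProfile` of routes RecurrentProfiles / DulacContraction implies the finite piece. -/
theorem stub_finiteScaledEnergyLiouville_of_noTypeIRateProfile
    (h : Summit.NavierStokesRegularity.NavierStokesRegularity.Theses.RecurrentProfiles.NoTypeIRateProfile) :
    Sig.stub_finiteScaledEnergyLiouville :=
  Summit.NavierStokesRegularity.NavierStokesRegularity.Theorems.FrequencyRigidity.ScaledEnergySplit.stub_finiteOfNoTypeIRateProfile h

/-- **Stub 2 ⇐ ¬LocalTypeISingularityExists** (landed `stub_finiteOfNoLocalTypeISingularity`): a counterexample to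
the finite piece would be a local Type-I singularity in Albritton–Barker's printed sense. -/
theorem stub_finiteScaledEnergyLiouville_of_noLocalTypeISingularity
    (h : ¬ Literature.Analysis.FluidPDE.LocalTypeISingularityExists) : Sig.stub_finiteScaledEnergyLiouville :=
  Summit.NavierStokesRegularity.NavierStokesRegularity.Theorems.FrequencyRigidity.ScaledEnergySplit.stub_finiteOfNoLocalTypeISingularity h

/-- **The axisymmetric case of Stub 2 is CLOSED** (landed `stub_finiteAxisymmetricLeaf`): no axisymmetric witness
of the crux body has finite Albritton–Barker quantity. -/
theorem stub_finiteScaledEnergyLiouville_axisymmetric :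
    ∀ (ν C Λ₀ : ℝ) (v : ℝ → EuclideanSpace ℝ (Fin 3) → EuclideanSpace ℝ (Fin 3)) (q : ℝ → EuclideanSpace ℝ (Fin 3) → ℝ) (K : ℝ → EuclideanSpace ℝ (Fin 3) → ℝ), (0 < ν ∧ Literature.Analysis.FluidPDE.IsClassicalNSSolutionOn (Set.Iio 0) ν 0 v q ∧ (∀ t ∈ Set.Iio (0:ℝ), ∀ x, ‖v t x‖ ≤ C / Real.sqrt (-t)) ∧ ContDiffOn ℝ 2 (Function.uncurry K) (Set.Iio (0:ℝ) ×ˢ Set.univ) ∧ (∀ t ∈ Set.Iio (0:ℝ), ∀ x, 0 < K t x) ∧ (∀ t ∈ Set.Iio (0:ℝ), ∀ x, Literature.Analysis.FluidPDE.timeDerivWithin (Set.Iio (0:ℝ)) K t x + fderiv ℝ (K t) x (v t x) + ν * Laplacian.laplacian (K t) x = 0) ∧ (∀ t ∈ Set.Iio (0:ℝ), ∫ x, K t x = 1) ∧ (∀ φ : EuclideanSpace ℝ (Fin 3) → ℝ, Continuous φ → (∃ M : ℝ, ∀ x, |φ x| ≤ M) → Filter.Tendsto (fun t => ∫ x, φ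 x * K t x) (nhdsWithin (0:ℝ) (Set.Iio (0:ℝ))) (nhds (φ (0 : EuclideanSpace ℝ (Fin 3))))) ∧ (∃ c₁ c₂ C₁ C₂ : ℝ, 0 < c₁ ∧ 0 < c₂ ∧ 0 < C₁ ∧ 0 < C₂ ∧ ∀ t ∈ Set.Iio (0:ℝ), ∀ x, c₁ * ((0:ℝ) - t) ^ (-(3:ℝ) / 2) * Real.exp (-(‖x - (0 : EuclideanSpace ℝ (Fin 3))‖ ^ 2) / (c₂ * ((0:ℝ) - t))) ≤ K t x ∧ K t x ≤ C₁ * ((0:ℝ) - t) ^ (-(3:ℝ) / 2) * Real.exp (-(‖x - (0 : EuclideanSpace ℝ (Fin 3))‖ ^ 2) / (C₂ * ((0:ℝ) - t)))) ∧ (∀ H Λ : ℝ → ℝ, H = (fun t => ∫ x, ‖Literature.Analysis.FluidPDE.curl (v t) x‖ ^ 2 * K t x) → Λ = (fun t => (0 - t) * deriv H t / H t) → (∀ t ∈ Set.Iio (0:ℝ), 0 < H t) ∧ (∀ t ∈ Set.Iio (0:ℝ), Λ t = Λ₀))) → Literature.Analysis.FluidPDE.typeIBound (Set.Iio (0:ℝ)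 ×ˢ Set.univ) v q (fun t x => fderiv ℝ (v t) x) < ⊤ → (∀ t ∈ Set.Iio (0:ℝ), Literature.Analysis.FluidPDE.IsAxisymmetric (v t)) → False :=
  Summit.NavierStokesRegularity.NavierStokesRegularity.Theorems.FrequencyRigidity.ScaledEnergySplit.stub_finiteAxisymmetricLeaf

/-- **The split is exact and the finite child is Stub 2's statement** (landed glue p139934 + Stub 1). -/
theorem finitePiece_iff_stub2 : Sig.finiteScaledEnergyPiece ↔ Sig.stub_finiteScaledEnergyLiouville :=
  Summit.NavierStokesRegularity.NavierStokesRegularity.Theorems.FrequencyRigidity.ScaledEnergySplit.finitePiece_iff_frame0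

/-- Hence the whole crux modulo Stub 3 follows from stmt-1588 (and Stub 3 is route-irrelevant). -/
theorem FrequencyRigidity_of_noTypeIRateProfile
    (h : Summit.NavierStokesRegularity.NavierStokesRegularity.Theses.RecurrentProfiles.NoTypeIRateProfile)
    (h2 : Sig.stub_infiniteScaledEnergyLiouville) :
    Summit.NavierStokesRegularity.NavierStokesRegularity.Theses.AdaptedFrequency.FrequencyRigidity :=
  FrequencyRigidity_of stub_frameNormalisation (stub_finiteScaledEnergyLiouville_of_noTypeIRateProfile h) h2

/-! ### Registered sub-goals of Stub 2 (lead c7): the rotated-self-similar content of the finite piece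

The only inhabitants of Stub 2 anybody can name are rotated-self-similar (RSS) flows
`v = pvAnsatz α U` (Pineau–Vicol 2026 (1.7); unit viscosity — general `ν` reduces to `ν = 1` by
`stub_viscosityNormalisation`, the profile being rotated and dilated).  The five sub-goals below make the RSS
content of Stub 2 EXACTLY Pineau–Vicol's Conjecture 1.1 on its window:

* (A) `stub_finiteRSSProfileDecay` — an RSS flow in the Albritton–Barker class (`𝐈 < ∞`) has a profile with the
  POINTWISE decay `‖U(y)‖ ≤ C₀/(1+‖y‖)` = PV's Type I bound (1.10).  Tsai 1998 §4 transplanted to RSS: the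
  top singular set of the unit backward cylinder is `μH[1]`-null (`tsai1998_top_singular_null_holds`, PROVED),
  whereas a non-decay sequence `‖yₖ‖‖U(yₖ)‖ → ∞` makes every point of the spiral
  `{σ R(−2α log σ) e* : 0 < σ < 1}` (`e*` an accumulation point of the ROTATED directions `R(2α log‖yₖ‖) yₖ/‖yₖ‖`)
  a backward singular point at `t = 0`; the 1-Lipschitz norm map sends the spiral onto `(0,1)`, so its `μH[1]`
  measure is `≥ 1`.  (Closes the census's "Morrey → pointwise" gap and lead c4's "pointwise (1.10) for tangent
  flows not in print", for RSS.)
* (B) `stub_finiteRSSExtremes` — PV Thm 1.4 (`pineauVicol2026_rss_liouville_holds`, PROVED): a decaying RSS flow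
  with `|α| < α₁(C₀)` or `|α| > α₂(C₀)` has `U ≡ 0`, incompatible with a positive adapted enstrophy.
* (C1) `stub_rssDecaySuitableInBall` + (C2) `stub_rssTypeIBoundOfBall` ⇒ (C) `rssDecay_typeIBound_lt_top` —
  conversely a decaying RSS flow lies in the A–B class: suitable in the unit parabolic ball at the vertex with
  `A` bounded on sub-balls (PV Lemma 7.1 gradient bounds, pressure = potential up to a time gauge), then A–B
  Lemma 2.6 (`albrittonBarker2019_lemma_2_6_holds`, PROVED) and discrete self-similarity (`λ = e^{π/|α|}`)
  exhaust the lower half space.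
* (D) `stub_finiteClassWall` — hence Stub 2 ⇒ PV Conj 1.1 (smooth bounded-gradient decaying class, every
  `α`): the finite-class analogue of `rssWall_unconditional` (co-rotating kernel from
  `coRotatingKernelHypothesis_holds`, flat power law `adaptedEnstrophy_rss`, `𝐈 < ∞` from (C)).

(A)+(B): every RSS witness of Stub 2 has `α` in PV's window `[α₁(C₀), α₂(C₀)]`, `C₀` its own decay constant;
(C)+(D): every smooth decaying RSS profile on the window would BE a witness.  None of these is a `¬`-claim
about the route. -/

/-- **Sub-goal (A) of Stub 2 — RSS witnesses of the finite piece have Pineau–Vicol-decaying profiles.**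
A classical unit-viscosity flow on `(−∞,0)` of rotated-self-similar form `u = pvAnsatz α U` with finite
Albritton–Barker quantity `𝐈(ℝ³ × ℝ₋) < ∞` has `‖U(y)‖ ≤ C₀/(1 + ‖y‖)`.  (Tsai 1998, Cor. 4.3 for `α = 0`;
the spiral version for `α ≠ 0` is new bookkeeping over `tsai1998_top_singular_null_holds`.) -/
theorem stub_finiteRSSProfileDecay : ∀ (α : ℝ) (U : EuclideanSpace ℝ (Fin 3) → EuclideanSpace ℝ (Fin 3)) (u : ℝ → EuclideanSpace ℝ (Fin 3) → EuclideanSpace ℝ (Fin 3)) (p : ℝ → EuclideanSpace ℝ (Fin 3) → ℝ), Literature.Analysis.FluidPDE.IsClassicalNSSolutionOn (Set.Iio 0) 1 0 u p → (∀ t ∈ Set.Iio (0:ℝ), ∀ x, u t x = Literature.Analysis.FluidPDE.pvAnsatz α (fun y _ => U y) t x) → Literature.Analysis.FluidPDE.typeIBound (Set.Iio (0:ℝ) ×ˢ Set.univ) u p (fun t x => fderiv ℝ (u t) x) < ⊤ → ∃ C₀ : ℝ, 0 < C₀ ∧ ∀ y, ‖U y‖ ≤ C₀ / (1 + ‖y‖)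 :=
  Summit.NavierStokesRegularity.NavierStokesRegularity.Theorems.FrequencyRigidity.ScaledEnergySplit.stub_finiteRSSProfileDecay

/-- **Sub-goal (B) of Stub 2 — the RSS case outside Pineau–Vicol's window is CLOSED.**  For every decay
constant `C₀ > 0` there are `α₁, α₂ > 0` (PV Thm 1.4) such that no classical unit-viscosity RSS flow
`v = pvAnsatz α U` on `(−∞,0)` with `‖U(y)‖ ≤ C₀/(1+‖y‖)`, `|α| < α₁ ∨ α₂ < |α|`, has positive weighted enstrophy
`∫‖curl v(t)‖² K(t) > 0` (for ANY weight `K`): PV force `U ≡ 0`. -/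
theorem stub_finiteRSSExtremes : ∀ C₀ : ℝ, 0 < C₀ → ∃ α₁ α₂ : ℝ, 0 < α₁ ∧ 0 < α₂ ∧ ∀ (α : ℝ) (U : EuclideanSpace ℝ (Fin 3) → EuclideanSpace ℝ (Fin 3)) (v : ℝ → EuclideanSpace ℝ (Fin 3) → EuclideanSpace ℝ (Fin 3)) (q : ℝ → EuclideanSpace ℝ (Fin 3) → ℝ) (K : ℝ → EuclideanSpace ℝ (Fin 3) → ℝ), Literature.Analysis.FluidPDE.IsClassicalNSSolutionOn (Set.Iio 0) 1 0 v q → (∀ t ∈ Set.Iio (0:ℝ), ∀ x, v t x = Literature.Analysis.FluidPDE.pvAnsatz α (fun y _ => U y) t x) → (∀ y, ‖U y‖ ≤ C₀ / (1 + ‖y‖)) → (∀ t ∈ Set.Iio (0:ℝ), 0 < ∫ x, ‖Literature.Analysis.FluidPDE.curl (v t) x‖ ^ 2 * K t x) → (|α| < α₁ ∨ α₂ < |α|) → False :=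
  Summit.NavierStokesRegularity.NavierStokesRegularity.Theorems.FrequencyRigidity.ScaledEnergySplit.stub_finiteRSSExtremes

/-- **Sub-goal (C1) of Stub 2 — decaying RSS flows are suitable in the unit parabolic ball at the vertex, in
Albritton–Barker's class (Def. 2.1), for some time gauge of the pressure, with the scaled energy `A` bounded
over all parabolic sub-balls.**  (Energy class and `A` from the decay; `∇u ∈ L²(Q)` from PV Lemma 7.1
`exists_forall_iteratedFDeriv_le_of_typeI`; the gauged pressure is the potential `Q[u(t)]`,
`gradient_pressure_eq_of_typeI_vertex`, in `L^{3/2}(Q)`.) -/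
theorem stub_rssDecaySuitableInBall : ∀ (α C₀ : ℝ) (U : EuclideanSpace ℝ (Fin 3) → EuclideanSpace ℝ (Fin 3)) (u : ℝ → EuclideanSpace ℝ (Fin 3) → EuclideanSpace ℝ (Fin 3)) (p : ℝ → EuclideanSpace ℝ (Fin 3) → ℝ), Literature.Analysis.FluidPDE.IsClassicalNSSolutionOn (Set.Iio 0) 1 0 u p → (∀ t ∈ Set.Iio (0:ℝ), ∀ x, u t x = Literature.Analysis.FluidPDE.pvAnsatz α (fun y _ => U y) t x) → (∀ y, ‖U y‖ ≤ C₀ / (1 + ‖y‖)) → ∃ c : ℝ → ℝ, Literature.Analysis.FluidPDE.IsSuitableWeakSolutionInBall 1 0 u (fun t x => p t x - c t) ∧ ∃ M : NNReal, ∀ (r : ℝ) (z : ℝ × EuclideanSpace ℝ (Fin 3)), 0 < r → Literature.Analysis.FluidPDE.parabolicCylinder r z ⊆ Literature.Analysis.FluidPDE.parabolicCylinder 1 0 → Literature.Analysis.FluidPDE.cknAEss r z u ≤ M :=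
  Summit.NavierStokesRegularity.NavierStokesRegularity.Theorems.FrequencyRigidity.ScaledEnergySplit.stub_rssDecaySuitableInBall

/-- **Sub-goal (C2) of Stub 2 — from the unit ball to the lower half space.**  An RSS flow, suitable in the
unit parabolic ball at the vertex in A–B's class (some pressure gauge) with `A` bounded on sub-balls, has
`𝐈(ℝ³ × ℝ₋) < ∞`: A–B Lemma 2.6 (`albrittonBarker2019_lemma_2_6_holds`, `A`-case) gives `𝐈(Q((0,0),½)) < ∞`,
the flow is discretely self-similar with factor `e^{π/|α|}` (`α ≠ 0`; any factor if `α = 0`), `𝐈` of a ball is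
scale-invariant and gauge-invariant, and the dilated balls exhaust `ℝ³ × ℝ₋`. -/
theorem stub_rssTypeIBoundOfBall : ∀ (α : ℝ) (U : EuclideanSpace ℝ (Fin 3) → EuclideanSpace ℝ (Fin 3)) (u : ℝ → EuclideanSpace ℝ (Fin 3) → EuclideanSpace ℝ (Fin 3)) (p : ℝ → EuclideanSpace ℝ (Fin 3) → ℝ) (c : ℝ → ℝ), Literature.Analysis.FluidPDE.IsClassicalNSSolutionOn (Set.Iio 0) 1 0 u p → (∀ t ∈ Set.Iio (0:ℝ), ∀ x, u t x = Literature.Analysis.FluidPDE.pvAnsatz α (fun y _ => U y) t x) → Literature.Analysis.FluidPDE.IsSuitableWeakSolutionInBall 1 0 u (fun t x => p t x - c t) → (∃ M : NNReal, ∀ (r : ℝ) (z : ℝ × EuclideanSpace ℝ (Fin 3)), 0 < r → Literature.Analysis.FluidPDE.parabolicCylinder r z ⊆ Literature.Analysis.FluidPDE.parabolicCylinder 1 0 → Literature.Analysis.FluidPDE.cknAEss r z u ≤ M) → Literature.Analysis.FluidPDE.typeIBound (Set.Iio (0:ℝ) ×ˢ Set.univ) u p (fun t x => fderiv ℝ (u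 t) x) < ⊤ :=
  Summit.NavierStokesRegularity.NavierStokesRegularity.Theorems.FrequencyRigidity.ScaledEnergySplit.stub_rssTypeIBoundOfBall

/-- **(C) Decaying RSS flows lie in the Albritton–Barker class** — composition of (C1) and (C2). -/
theorem rssDecay_typeIBound_lt_top : ∀ (α C₀ : ℝ) (U : EuclideanSpace ℝ (Fin 3) → EuclideanSpace ℝ (Fin 3)) (u : ℝ → EuclideanSpace ℝ (Fin 3) → EuclideanSpace ℝ (Fin 3)) (p : ℝ → EuclideanSpace ℝ (Fin 3) → ℝ), Literature.Analysis.FluidPDE.IsClassicalNSSolutionOn (Set.Iio 0) 1 0 u p → (∀ t ∈ Set.Iio (0:ℝ), ∀ x, u t x = Literature.Analysis.FluidPDE.pvAnsatz α (fun y _ => U y) t x) → (∀ y, ‖U y‖ ≤ C₀ / (1 + ‖y‖)) → Literature.Analysis.FluidPDE.typeIBound (Set.Iio (0:ℝ) ×ˢ Set.univ) u p (fun t x => fderiv ℝ (u t) x) < ⊤ := by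
  intro α C₀ U u p hsol hA hdec
  obtain ⟨c, hball, hM⟩ := stub_rssDecaySuitableInBall α C₀ U u p hsol hA hdec
  exact stub_rssTypeIBoundOfBall α U u p c hsol hA hball hM

/-- **Sub-goal (D) of Stub 2 — the finite-class wall.**  Stub 2 together with (C) implies Pineau–Vicol's
Conjecture 1.1 in the smooth, bounded-gradient, decaying class, for EVERY `α`: a co-rotating adapted
comparable kernel exists (`coRotatingKernelHypothesis_holds`), the adapted enstrophy is then `A(−t)⁻²` with
`A = ∫‖curl U‖²𝒦` (`adaptedEnstrophy_rss`), so `A > 0` would be a witness of Stub 2's body with `𝐈 < ∞`. -/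
theorem stub_finiteClassWall : (¬ ∃ (ν C Λ₀ : ℝ) (v : ℝ → EuclideanSpace ℝ (Fin 3) → EuclideanSpace ℝ (Fin 3)) (q : ℝ → EuclideanSpace ℝ (Fin 3) → ℝ) (K : ℝ → EuclideanSpace ℝ (Fin 3) → ℝ), (0 < ν ∧ Literature.Analysis.FluidPDE.IsClassicalNSSolutionOn (Set.Iio 0) ν 0 v q ∧ (∀ t ∈ Set.Iio (0:ℝ), ∀ x, ‖v t x‖ ≤ C / Real.sqrt (-t)) ∧ ContDiffOn ℝ 2 (Function.uncurry K) (Set.Iio (0:ℝ) ×ˢ Set.univ) ∧ (∀ t ∈ Set.Iio (0:ℝ), ∀ x, 0 < K t x) ∧ (∀ t ∈ Set.Iio (0:ℝ), ∀ x, Literature.Analysis.FluidPDE.timeDerivWithin (Set.Iio (0:ℝ)) K t x + fderiv ℝ (K t) x (v t x) + ν * Laplacian.laplacian (K t) x = 0) ∧ (∀ t ∈ Set.Iio (0:ℝ), ∫ x, K t x = 1) ∧ (∀ φ : EuclideanSpace ℝ (Fin 3) → ℝ, Continuous φ → (∃ M : ℝ, ∀ x, |φ x| ≤ M) → Filter.Tendsto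 (fun t => ∫ x, φ x * K t x) (nhdsWithin (0:ℝ) (Set.Iio (0:ℝ))) (nhds (φ (0 : EuclideanSpace ℝ (Fin 3))))) ∧ (∃ c₁ c₂ C₁ C₂ : ℝ, 0 < c₁ ∧ 0 < c₂ ∧ 0 < C₁ ∧ 0 < C₂ ∧ ∀ t ∈ Set.Iio (0:ℝ), ∀ x, c₁ * ((0:ℝ) - t) ^ (-(3:ℝ) / 2) * Real.exp (-(‖x - (0 : EuclideanSpace ℝ (Fin 3))‖ ^ 2) / (c₂ * ((0:ℝ) - t))) ≤ K t x ∧ K t x ≤ C₁ * ((0:ℝ) - t) ^ (-(3:ℝ) / 2) * Real.exp (-(‖x - (0 : EuclideanSpace ℝ (Fin 3))‖ ^ 2) / (C₂ * ((0:ℝ) - t)))) ∧ (∀ H Λ : ℝ → ℝ, H = (fun t => ∫ x, ‖Literature.Analysis.FluidPDE.curl (v t) x‖ ^ 2 * K t x) → Λ = (fun t => (0 - t) * deriv H t / H t) → (∀ t ∈ Set.Iio (0:ℝ), 0 < H t) ∧ (∀ t ∈ Set.Iio (0:ℝ), Λ t = Λ₀))) ∧ Literature.Analysis.FluidPDE.typeIBound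 (Set.Iio (0:ℝ) ×ˢ Set.univ) v q (fun t x => fderiv ℝ (v t) x) < ⊤) → (∀ (α C₀ : ℝ) (U : EuclideanSpace ℝ (Fin 3) → EuclideanSpace ℝ (Fin 3)) (u : ℝ → EuclideanSpace ℝ (Fin 3) → EuclideanSpace ℝ (Fin 3)) (p : ℝ → EuclideanSpace ℝ (Fin 3) → ℝ), Literature.Analysis.FluidPDE.IsClassicalNSSolutionOn (Set.Iio 0) 1 0 u p → (∀ t ∈ Set.Iio (0:ℝ), ∀ x, u t x = Literature.Analysis.FluidPDE.pvAnsatz α (fun y _ => U y) t x) → (∀ y, ‖U y‖ ≤ C₀ / (1 + ‖y‖)) → Literature.Analysis.FluidPDE.typeIBound (Set.Iio (0:ℝ) ×ˢ Set.univ) u p (fun t x => fderiv ℝ (u t) x) < ⊤) → ∀ (α C₀ : ℝ) (U : EuclideanSpace ℝ (Fin 3) → EuclideanSpace ℝ (Fin 3)) (q : ℝ → EuclideanSpace ℝ (Fin 3) → ℝ), ContDiff ℝ (⊤ : ℕ∞) U → (∃ C : ℝ, ∀ y, ‖U y‖ ≤ C ∧ ‖fderiv ℝ U y‖ ≤ C)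 → (∀ y, ‖U y‖ ≤ C₀ / (1 + ‖y‖)) → Literature.Analysis.FluidPDE.IsClassicalNSSolutionOn (Set.Iio 0) 1 0 (Literature.Analysis.FluidPDE.pvAnsatz α (fun y _ => U y)) q → ∀ y, Literature.Analysis.FluidPDE.curl U y = 0 :=
  Summit.NavierStokesRegularity.NavierStokesRegularity.Theorems.FrequencyRigidity.ScaledEnergySplit.stub_finiteClassWall

/-- **The finite-class wall, assembled**: Stub 2 alone (with (C1), (C2) discharged in this skeleton by their
registered stubs) gives PV Conj 1.1 in the smooth bounded-gradient decaying class, every `α`. -/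
theorem pvConjecture_of_stub2 (h2 : Sig.stub_finiteScaledEnergyLiouville) :
    ∀ (α C₀ : ℝ) (U : EuclideanSpace ℝ (Fin 3) → EuclideanSpace ℝ (Fin 3)) (q : ℝ → EuclideanSpace ℝ (Fin 3) → ℝ), ContDiff ℝ (⊤ : ℕ∞) U → (∃ C : ℝ, ∀ y, ‖U y‖ ≤ C ∧ ‖fderiv ℝ U y‖ ≤ C) → (∀ y, ‖U y‖ ≤ C₀ / (1 + ‖y‖)) → Literature.Analysis.FluidPDE.IsClassicalNSSolutionOn (Set.Iio 0) 1 0 (Literature.Analysis.FluidPDE.pvAnsatz α (fun y _ => U y)) q → ∀ y, Literature.Analysis.FluidPDE.curl U y = 0 :=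
  stub_finiteClassWall h2 rssDecay_typeIBound_lt_top

/-! ### The RSS content of Stub 2, assembled (lead c7): sub-goals (F) `stub_rssViscosityNormalisation`
(p144967), (H) `stub_rssWitnessDecays`, (G) `stub_rssWitnessWindow` carry (A), (B) to every viscosity.

Read together: every rotated-self-similar witness `(ν, C, Λ₀, v = pvAnsatz α U, q, K)` of Stub 2's body with
`𝐈 < ∞` has a Pineau–Vicol-decaying profile (H), and for each viscosity `ν` and decay constant `C₀` the admissible
angular speeds form a window `[α₁(ν,C₀), α₂(ν,C₀)]` with `α₁ > 0` (G) — Pineau–Vicol's Conjecture 1.1 on its window,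
and nothing else, is what an RSS inhabitant of Stub 2 would violate. -/

/-- **Every RSS witness of Stub 2's body (any viscosity) has a Pineau–Vicol-decaying profile** (sub-goal (H)). -/
theorem rss_witness_decays :
    ∀ (ν α : ℝ) (U : EuclideanSpace ℝ (Fin 3) → EuclideanSpace ℝ (Fin 3)) (C Λ₀ : ℝ) (v : ℝ → EuclideanSpace ℝ (Fin 3) → EuclideanSpace ℝ (Fin 3)) (q : ℝ → EuclideanSpace ℝ (Fin 3) → ℝ) (K : ℝ → EuclideanSpace ℝ (Fin 3) → ℝ), ((0 < ν ∧ Literature.Analysis.FluidPDE.IsClassicalNSSolutionOn (Set.Iio 0) ν 0 v q ∧ (∀ t ∈ Set.Iio (0:ℝ), ∀ x, ‖v t x‖ ≤ C / Real.sqrt (-t)) ∧ ContDiffOn ℝ 2 (Function.uncurry K) (Set.Iio (0:ℝ) ×ˢ Set.univ) ∧ (∀ t ∈ Set.Iio (0:ℝ), ∀ x, 0 < K t x) ∧ (∀ t ∈ Set.Iio (0:ℝ), ∀ x, Literature.Analysis.FluidPDE.timeDerivWithin (Set.Iio (0:ℝ)) K t x + fderiv ℝ (K t) x (v t x) + ν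 * Laplacian.laplacian (K t) x = 0) ∧ (∀ t ∈ Set.Iio (0:ℝ), ∫ x, K t x = 1) ∧ (∀ φ : EuclideanSpace ℝ (Fin 3) → ℝ, Continuous φ → (∃ M : ℝ, ∀ x, |φ x| ≤ M) → Filter.Tendsto (fun t => ∫ x, φ x * K t x) (nhdsWithin (0:ℝ) (Set.Iio (0:ℝ))) (nhds (φ (0 : EuclideanSpace ℝ (Fin 3))))) ∧ (∃ c₁ c₂ C₁ C₂ : ℝ, 0 < c₁ ∧ 0 < c₂ ∧ 0 < C₁ ∧ 0 < C₂ ∧ ∀ t ∈ Set.Iio (0:ℝ), ∀ x, c₁ * ((0:ℝ) - t) ^ (-(3:ℝ) / 2) * Real.exp (-(‖x - (0 : EuclideanSpace ℝ (Fin 3))‖ ^ 2) / (c₂ * ((0:ℝ) - t))) ≤ K t x ∧ K t x ≤ C₁ * ((0:ℝ) - t) ^ (-(3:ℝ) / 2) * Real.exp (-(‖x - (0 : EuclideanSpace ℝ (Fin 3))‖ ^ 2) / (C₂ * ((0:ℝ) - t)))) ∧ (∀ H Λ : ℝ → ℝ, H = (fun t => ∫ x, ‖Literature.Analysis.FluidPDE.curl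 (v t) x‖ ^ 2 * K t x) → Λ = (fun t => (0 - t) * deriv H t / H t) → (∀ t ∈ Set.Iio (0:ℝ), 0 < H t) ∧ (∀ t ∈ Set.Iio (0:ℝ), Λ t = Λ₀))) ∧ Literature.Analysis.FluidPDE.typeIBound (Set.Iio (0:ℝ) ×ˢ Set.univ) v q (fun t x => fderiv ℝ (v t) x) < ⊤) → (∀ t ∈ Set.Iio (0:ℝ), ∀ x, v t x = Literature.Analysis.FluidPDE.pvAnsatz α (fun y _ => U y) t x) → ∃ C₀ : ℝ, 0 < C₀ ∧ ∀ y, ‖U y‖ ≤ C₀ / (1 + ‖y‖) := by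
  intro ν α U C Λ₀ v q K hb hA
  obtain ⟨⟨hν, hNS, -, -, -, -, -, -, -, -⟩, hI⟩ := hb
  exact Summit.NavierStokesRegularity.NavierStokesRegularity.Theorems.FrequencyRigidity.ScaledEnergySplit.stub_rssWitnessDecays
    ν α U v q hν hNS hA hI

/-- **The admissible angular speeds of RSS witnesses of Stub 2's body form Pineau–Vicol's window** (sub-goal
(G)): for every viscosity `ν > 0` and decay constant `C₀ > 0` there are `α₁, α₂ > 0` such that every RSS witness with
viscosity `ν` and profile decay constant `C₀` has `α₁ ≤ |α| ≤ α₂` — in particular no self-similar (`α = 0`) witness. -/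
theorem rss_witness_in_window :
    ∀ (ν C₀ : ℝ), 0 < ν → 0 < C₀ → ∃ α₁ α₂ : ℝ, 0 < α₁ ∧ 0 < α₂ ∧ ∀ (α : ℝ) (U : EuclideanSpace ℝ (Fin 3) → EuclideanSpace ℝ (Fin 3)) (C Λ₀ : ℝ) (v : ℝ → EuclideanSpace ℝ (Fin 3) → EuclideanSpace ℝ (Fin 3)) (q : ℝ → EuclideanSpace ℝ (Fin 3) → ℝ) (K : ℝ → EuclideanSpace ℝ (Fin 3) → ℝ), (Literature.Analysis.FluidPDE.IsClassicalNSSolutionOn (Set.Iio 0) ν 0 v q ∧ (∀ t ∈ Set.Iio (0:ℝ), ∀ x, ‖v t x‖ ≤ C / Real.sqrt (-t)) ∧ ContDiffOn ℝ 2 (Function.uncurry K) (Set.Iio (0:ℝ) ×ˢ Set.univ) ∧ (∀ t ∈ Set.Iio (0:ℝ), ∀ x, 0 < K t x) ∧ (∀ t ∈ Set.Iio (0:ℝ), ∀ x, Literature.Analysis.FluidPDE.timeDerivWithin (Set.Iio (0:ℝ)) K t x + fderiv ℝ (K t) x (v t x) + ν * Laplacian.laplacian (K t) x = 0) ∧ (∀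 t ∈ Set.Iio (0:ℝ), ∫ x, K t x = 1) ∧ (∀ φ : EuclideanSpace ℝ (Fin 3) → ℝ, Continuous φ → (∃ M : ℝ, ∀ x, |φ x| ≤ M) → Filter.Tendsto (fun t => ∫ x, φ x * K t x) (nhdsWithin (0:ℝ) (Set.Iio (0:ℝ))) (nhds (φ (0 : EuclideanSpace ℝ (Fin 3))))) ∧ (∃ c₁ c₂ C₁ C₂ : ℝ, 0 < c₁ ∧ 0 < c₂ ∧ 0 < C₁ ∧ 0 < C₂ ∧ ∀ t ∈ Set.Iio (0:ℝ), ∀ x, c₁ * ((0:ℝ) - t) ^ (-(3:ℝ) / 2) * Real.exp (-(‖x - (0 : EuclideanSpace ℝ (Fin 3))‖ ^ 2) / (c₂ * ((0:ℝ) - t))) ≤ K t x ∧ K t x ≤ C₁ * ((0:ℝ) - t) ^ (-(3:ℝ) / 2) * Real.exp (-(‖x - (0 : EuclideanSpace ℝ (Fin 3))‖ ^ 2) / (C₂ * ((0:ℝ) - t)))) ∧ (∀ H Λ : ℝ → ℝ, H = (fun t => ∫ x, ‖Literature.Analysis.FluidPDE.curl (v t) x‖ ^ 2 * K t x) → Λ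 = (fun t => (0 - t) * deriv H t / H t) → (∀ t ∈ Set.Iio (0:ℝ), 0 < H t) ∧ (∀ t ∈ Set.Iio (0:ℝ), Λ t = Λ₀))) → (∀ t ∈ Set.Iio (0:ℝ), ∀ x, v t x = Literature.Analysis.FluidPDE.pvAnsatz α (fun y _ => U y) t x) → (∀ y, ‖U y‖ ≤ C₀ / (1 + ‖y‖)) → α₁ ≤ |α| ∧ |α| ≤ α₂ := by
  intro ν C₀ hν hC₀
  obtain ⟨α₁, α₂, hα₁, hα₂, hG⟩ :=
    Summit.NavierStokesRegularity.NavierStokesRegularity.Theorems.FrequencyRigidity.ScaledEnergySplit.stub_rssWitnessWindow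
      ν C₀ hν hC₀
  refine ⟨α₁, α₂, hα₁, hα₂, fun α U C Λ₀ v q K hb hA hdec => ?_⟩
  obtain ⟨hNS, -, -, -, -, -, -, -, hF⟩ := hb
  exact hG α U v q K hNS hA hdec ((hF _ _ rfl rfl).1)

/-! ### Sub-goal (E) of Stub 2 (lead c7, wave 2): the small-scaled-energy gap

Complementing the small-Type-I-constant gap S3a–c of line `two-ended-pinning` (p107013/p107082/p107150): Stub 2
also holds for witnesses with SMALL Albritton–Barker quantity, by backward ε-regularity at the vertex
(Seregin 2014 Ch. 6 Thm 1.4, `seregin2014_thm14_holds`, PROVED) against the backward singularity of the pole of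
every witness (`isBackwardSingularPoint_of_witness`, lead c6, p138216). -/

/-- **Sub-goal (E) of Stub 2 — small scaled energy forces a regular vertex.**  There is an absolute `ε > 0`
such that a classical unit-viscosity Navier–Stokes flow on `(−∞,0)` with Albritton–Barker quantity
`𝐈(ℝ³ × ℝ₋) < ε` is NOT backward-singular at the space–time origin (slab packaging
`isLocalTypeISingularPoint_of_slabProfile` + Seregin's `E`-criterion `seregin2014_thm14_holds` at the vertex:
`sup_{0<r<1} E(Q((0,0),r)) ≤ 𝐈 < ε`). -/
theorem stub_smallScaledEnergyRegular : ∃ ε : ℝ, 0 < ε ∧ ∀ (u : ℝ → EuclideanSpace ℝ (Fin 3) → EuclideanSpace ℝ (Fin 3)) (p : ℝ → EuclideanSpace ℝ (Fin 3) → ℝ), Literature.Analysis.FluidPDE.IsClassicalNSSolutionOn (Set.Iio 0) 1 0 u p → Literature.Analysis.FluidPDE.typeIBound (Set.Iio (0:ℝ) ×ˢ Set.univ) u p (fun t x => fderiv ℝ (u t) x) < ENNReal.ofReal ε → ¬ Literature.Analysis.FluidPDE.IsBackwardSingularPoint u 0 :=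
  Summit.NavierStokesRegularity.NavierStokesRegularity.Theorems.FrequencyRigidity.ScaledEnergySplit.stub_smallScaledEnergyRegular

/-- **The small-scaled-energy gap of Stub 2** (from (E) and the backward singularity of the pole of every
witness): there is an absolute `ε > 0` such that no unit-viscosity witness of Stub 2's body has `𝐈 < ε`. -/
theorem stub2_smallScaledEnergyGap : ∃ ε : ℝ, 0 < ε ∧ ∀ (C Λ₀ : ℝ) (v : ℝ → EuclideanSpace ℝ (Fin 3) → EuclideanSpace ℝ (Fin 3)) (q : ℝ → EuclideanSpace ℝ (Fin 3) → ℝ) (K : ℝ → EuclideanSpace ℝ (Fin 3) → ℝ), (Literature.Analysis.FluidPDE.IsClassicalNSSolutionOn (Set.Iio 0) 1 0 v q ∧ (∀ t ∈ Set.Iio (0:ℝ), ∀ x, ‖v t x‖ ≤ C / Real.sqrt (-t)) ∧ ContDiffOn ℝ 2 (Function.uncurry K) (Set.Iio (0:ℝ) ×ˢ Set.univ) ∧ (∀ t ∈ Set.Iio (0:ℝ), ∀ x, 0 < K t x) ∧ (∀ t ∈ Set.Iio (0:ℝ), ∀ x, Literature.Analysis.FluidPDE.timeDerivWithin (Set.Iio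 (0:ℝ)) K t x + fderiv ℝ (K t) x (v t x) + 1 * Laplacian.laplacian (K t) x = 0) ∧ (∀ t ∈ Set.Iio (0:ℝ), ∫ x, K t x = 1) ∧ (∀ φ : EuclideanSpace ℝ (Fin 3) → ℝ, Continuous φ → (∃ M : ℝ, ∀ x, |φ x| ≤ M) → Filter.Tendsto (fun t => ∫ x, φ x * K t x) (nhdsWithin (0:ℝ) (Set.Iio (0:ℝ))) (nhds (φ (0 : EuclideanSpace ℝ (Fin 3))))) ∧ (∃ c₁ c₂ C₁ C₂ : ℝ, 0 < c₁ ∧ 0 < c₂ ∧ 0 < C₁ ∧ 0 < C₂ ∧ ∀ t ∈ Set.Iio (0:ℝ), ∀ x, c₁ * ((0:ℝ) - t) ^ (-(3:ℝ) / 2) * Real.exp (-(‖x - (0 : EuclideanSpace ℝ (Fin 3))‖ ^ 2) / (c₂ * ((0:ℝ) - t))) ≤ K t x ∧ K t x ≤ C₁ * ((0:ℝ) - t) ^ (-(3:ℝ) / 2) * Real.exp (-(‖x - (0 : EuclideanSpace ℝ (Fin 3))‖ ^ 2) / (C₂ * ((0:ℝ) - t)))) ∧ (∀ H Λ : ℝ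 → ℝ, H = (fun t => ∫ x, ‖Literature.Analysis.FluidPDE.curl (v t) x‖ ^ 2 * K t x) → Λ = (fun t => (0 - t) * deriv H t / H t) → (∀ t ∈ Set.Iio (0:ℝ), 0 < H t) ∧ (∀ t ∈ Set.Iio (0:ℝ), Λ t = Λ₀))) → Literature.Analysis.FluidPDE.typeIBound (Set.Iio (0:ℝ) ×ˢ Set.univ) v q (fun t x => fderiv ℝ (v t) x) < ENNReal.ofReal ε → False := by
  obtain ⟨ε, hε, hE⟩ := stub_smallScaledEnergyRegular
  refine ⟨ε, hε, fun C Λ₀ v q K hb hI => ?_⟩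
  obtain ⟨hNS, hTI, hK1, hK2, hK3, hK4, hK5, hCmp, hF⟩ := hb
  refine hE v q hNS hI ?_
  exact Summit.NavierStokesRegularity.NavierStokesRegularity.Theorems.FrequencyRigidity.ScaledEnergySplit.isBackwardSingularPoint_of_witness
    one_pos hNS hTI (by unfold Summit.NavierStokesRegularity.NavierStokesRegularity.Theorems.FrequencyRigidity.Negative.KernelClauses; exact ⟨hK1, hK2, hK3, hK4, hK5⟩) hCmp hF

/-! ### The finite-class wall in Pineau–Vicol's own terms -/

/-- **Stub 2 implies Pineau–Vicol's Conjecture 1.1 verbatim, for EVERY angular speed** (also on the open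
window): if `U : ℝ³ → ℝ³` is the profile of a classical unit-viscosity rotated-self-similar Navier–Stokes flow on
`(−∞,0)` (some pressure) with the decay (1.9) `‖U(y)‖ ≤ C₀/(1+‖y‖)`, then `U ≡ 0`.  The smoothness and
bounded-gradient hypotheses of `pvConjecture_of_stub2` are automatic (`U = u(−1)`; PV Lemma 7.1
`exists_forall_iteratedFDeriv_le_of_typeI`), and `curl U ≡ 0` with `div U = 0` and decay gives `U ≡ 0`
(`eq_zero_of_curl_eq_zero_of_isDivFree_of_norm_le`). -/
theorem pvConjecture_of_stub2' (h2 : Sig.stub_finiteScaledEnergyLiouville) :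
    ∀ (α C₀ : ℝ) (U : EuclideanSpace ℝ (Fin 3) → EuclideanSpace ℝ (Fin 3)) (q : ℝ → EuclideanSpace ℝ (Fin 3) → ℝ), Literature.Analysis.FluidPDE.IsClassicalNSSolutionOn (Set.Iio 0) 1 0 (Literature.Analysis.FluidPDE.pvAnsatz α (fun y _ => U y)) q → (∀ y, ‖U y‖ ≤ C₀ / (1 + ‖y‖)) → U = 0 := by
  intro α C₀ U q hsol hdec
  have hA : ∀ t ∈ Set.Iio (0:ℝ), ∀ x, Literature.Analysis.FluidPDE.pvAnsatz α (fun y _ => U y) t x =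
      Literature.Analysis.FluidPDE.pvAnsatz α (fun y _ => U y) t x := fun _ _ _ => rfl
  have hm1 : (-1 : ℝ) ∈ Set.Iio (0:ℝ) := by norm_num
  have hslice : Literature.Analysis.FluidPDE.pvAnsatz α (fun y _ => U y) (-1) = U :=
    funext fun x => Literature.Analysis.FluidPDE.pvAnsatz_neg_one α _ x
  -- smoothness of the profile
  have hUs : ContDiff ℝ (⊤ : ℕ∞) U := by
    have h := hsol.contDiff_velocity hm1
    rw [hslice] at h
    exact h.of_le (by norm_cast)
  have hU2 : ContDiff ℝ 2 U := hUs.of_le (by norm_cast)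
  -- boundedness of `U` and `DU` (PV Lemma 7.1 at `t = −1`)
  have hC₀ : 0 ≤ C₀ := by
    have h := (norm_nonneg _).trans (hdec 0)
    simpa using h
  have hTI := Summit.NavierStokesRegularity.NavierStokesRegularity.Theorems.FrequencyRigidity.ScaledEnergySplit.rss_typeI_of_profile_decay hA hdec
  obtain ⟨K₁, hK₁, hgrad⟩ := Literature.Analysis.FluidPDE.PineauVicol2026.exists_forall_iteratedFDeriv_le_of_typeI 1 C₀
  have hbd : ∃ C : ℝ, ∀ y, ‖U y‖ ≤ C ∧ ‖fderiv ℝ U y‖ ≤ C := by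
    refine ⟨max C₀ K₁, fun y => ⟨?_, ?_⟩⟩
    · exact ((hdec y).trans (div_le_self hC₀ (by linarith [norm_nonneg y]))).trans (le_max_left _ _)
    · have h := hgrad _ q hsol hTI (-1) hm1 y
      rw [hslice] at h
      have h1 : ‖fderiv ℝ U y‖ = ‖iteratedFDeriv ℝ 1 U y‖ := by
        rw [← norm_iteratedFDeriv_fderiv, norm_iteratedFDeriv_zero]
      have hmax : 1 ≤ max ‖y‖ (Real.sqrt (-(-1:ℝ))) := by
        rw [neg_neg, Real.sqrt_one]; exact le_max_right _ _
      have h2 : K₁ * ((max ‖y‖ (Real.sqrt (-(-1:ℝ))))⁻¹) ^ (1 + 1) ≤ K₁ := by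
        have h3 : ((max ‖y‖ (Real.sqrt (-(-1:ℝ))))⁻¹) ^ (1 + 1) ≤ 1 :=
          pow_le_one₀ (inv_nonneg.2 (zero_le_one.trans hmax)) (inv_le_one_of_one_le₀ hmax)
        nlinarith
      rw [h1]
      exact (h.trans h2).trans (le_max_right _ _)
  have hcurl := pvConjecture_of_stub2 h2 α C₀ U q hUs hbd hdec hsol
  have hdiv : Literature.Analysis.FluidPDE.VectorCalculus.IsDivFree U := by
    have h := hsol.divFree (-1) hm1
    rwa [hslice] at h
  exact Literature.Analysis.FluidPDE.PineauVicol2026.eq_zero_of_curl_eq_zero_of_isDivFree_of_norm_le hU2 hcurl hdiv hdec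

/-- **Dichotomy for rotated self-similar flows (A + C)**: a classical unit-viscosity RSS flow on `(−∞,0)` lies in
the Albritton–Barker class (`𝐈(ℝ³ × ℝ₋) < ∞`) if and only if its profile has Pineau–Vicol decay.  Hence the RSS
inhabitants of Stub 2 are exactly the decaying ones and those of Stub 3 exactly the non-decaying ones. -/
theorem rss_typeIBound_lt_top_iff_decay :
    ∀ (α : ℝ) (U : EuclideanSpace ℝ (Fin 3) → EuclideanSpace ℝ (Fin 3)) (u : ℝ → EuclideanSpace ℝ (Fin 3) → EuclideanSpace ℝ (Fin 3)) (p : ℝ → EuclideanSpace ℝ (Fin 3) → ℝ), Literature.Analysis.FluidPDE.IsClassicalNSSolutionOn (Set.Iio 0) 1 0 u p → (∀ t ∈ Set.Iio (0:ℝ), ∀ x, u t x = Literature.Analysis.FluidPDE.pvAnsatz α (fun y _ => U y) t x) → (Literature.Analysis.FluidPDE.typeIBound (Set.Iio (0:ℝ) ×ˢ Set.univ) u p (fun t x => fderiv ℝ (u t) x) < ⊤ ↔ ∃ C₀ : ℝ, 0 < C₀ ∧ ∀ y, ‖U y‖ ≤ C₀ / (1 + ‖y‖)) := by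
  intro α U u p hsol hA
  exact ⟨stub_finiteRSSProfileDecay α U u p hsol hA,
    fun ⟨C₀, _, hdec⟩ => rssDecay_typeIBound_lt_top α C₀ U u p hsol hA hdec⟩

end Summit.NavierStokesRegularity.NavierStokesRegularity.Cruxes.FrequencyRigidity.ScaledEnergySplit
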